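import Literature.RepresentationTheory.ModularTensorCategories.TemperleyLieb.Defs

/-!
# Temperley–Lieb recoupling theory (2/7): Partial traces, the Jones–Wenzl induction, positional cups and caps; The Temperley–Lieb subcategory, Schur lemma, weights and the trace, sphericality

Part of the sorry-free formalization of Kauffman–Lins' recoupling theory in the binor model
(definitions and overview: `TemperleyLieb/Defs.lean`). Theorem-only file.

## References
* L. H. Kauffman, S. Lins, *Temperley–Lieb Recoupling Theory and Invariants of 3-Manifolds* (1994). [KauffmanLins1994]
* G. Masbaum, P. Vogel, *3-valent graphs and the Kauffman bracket*, Pacific J. Math. 164 (1994). [MasbaumVogel1994]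
-/

noncomputable section

open BigOperators Finset

namespace Literature.RepresentationTheory.ModularTensorCategories

namespace TemperleyLieb

variable {K : Type*} [Field K]
variable {m n p m' n' p' m'' n'' : ℕ}

open Mor

namespace Mor

variable (A : K)

/-- Sliding through a partial trace (non-square): `rptr (Y (N ⊗ 𝟙)) = rptr Y ∘ N`. [folklore] -/
theorem rptr_comp_tens_idm (Y : Mor K (n + 1) (p + 1)) (N : Mor K m n) :
    rptr A (Y ⊚ (N ⊗ₘ idm 1)) = rptr A Y ⊚ N := by
  rw [rptr_def, rptr_def, ← tens_idm_comp_tens_idm, tens_idm_one_idm_one]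
  have h2 : (N ⊗ₘ idm 2 :) ⊚ (idm m ⊗ₘ cup A :) = (idm n ⊗ₘ cup A :) ⊚ N := by
    rw [tens_idm_comp_idm_tens, tens_eq_comp_right, tens_idm_zero]
  simp only [comp_assoc] at h2 ⊢
  rw [← comp_assoc _ (N ⊗ₘ idm 2 :), h2, comp_assoc]

/-- Sliding through a partial trace (non-square): `rptr ((P ⊗ 𝟙) Y) = P ∘ rptr Y`. [folklore] -/
theorem rptr_tens_idm_comp (P : Mor K n p) (Y : Mor K (m + 1) (n + 1)) :
    rptr A ((P ⊗ₘ idm 1) ⊚ Y) = P ⊚ rptr A Y := by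
  rw [rptr_def, rptr_def, ← tens_idm_comp_tens_idm, tens_idm_one_idm_one]
  have h1 : (idm p ⊗ₘ cap A :) ⊚ (P ⊗ₘ idm 2 :) = P ⊚ (idm n ⊗ₘ cap A :) := by
    rw [idm_tens_comp_tens_idm, tens_eq_comp_left, tens_idm_zero]
  simp only [comp_assoc] at h1 ⊢
  rw [h1]

/-- `rptr (X ⊗ 𝟙) = d · X` (a free loop). [cite: KauffmanLins1994, §9.1] -/
theorem rptr_tens_idm_one (X : Mor K n n) : rptr A (X ⊗ₘ idm 1) = dval A • X := by
  rw [rptr_def, tens_idm_one_idm_one, idm_tens_comp_tens_idm, tens_comp_tens, comp_idm, cap_cup,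
    tens_smul, tens_idm_zero]

/-- Sliding through a partial trace: `rptr ((P ⊗ 𝟙) Z (Q ⊗ 𝟙)) = P (rptr Z) Q`. [folklore] -/
theorem rptr_sandwich (P Q : Mor K n n) (Z : Mor K (n + 1) (n + 1)) :
    rptr A ((P ⊗ₘ idm 1) ⊚ Z ⊚ (Q ⊗ₘ idm 1)) = P ⊚ rptr A Z ⊚ Q := by
  rw [rptr_def, rptr_def, ← tens_idm_comp_tens_idm, ← tens_idm_comp_tens_idm, tens_idm_one_idm_one,
    tens_idm_one_idm_one]
  have h1 : (idm n ⊗ₘ cap A :) ⊚ (P ⊗ₘ idm 2 :) = P ⊚ (idm n ⊗ₘ cap A :) := by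
    rw [idm_tens_comp_tens_idm, tens_eq_comp_left, tens_idm_zero]
  have h2 : (Q ⊗ₘ idm 2 :) ⊚ (idm n ⊗ₘ cup A :) = (idm n ⊗ₘ cup A :) ⊚ Q := by
    rw [tens_idm_comp_idm_tens, tens_eq_comp_right, tens_idm_zero]
  simp only [comp_assoc] at h1 h2 ⊢
  rw [h1, ← comp_assoc, h2, comp_assoc]

/-- `rptr U = 𝟙₁`. [folklore] -/
theorem rptr_U (hA : A ≠ 0) : rptr A (U A) = idm 1 := by
  rw [rptr_def, U, ← tens_idm_comp_tens_idm]
  simp only [comp_assoc]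
  rw [zigzag_left A hA, idm_comp, zigzag_right A hA]

/-- `rptr (Y ⊗ Z) = Y ⊗ rptr Z`. [folklore] -/
theorem rptr_tens {k : ℕ} (Y : Mor K n n) (Z : Mor K (k + 1) (k + 1)) :
    rptr (m := n + k) (n := n + k) A (Y ⊗ₘ Z :) = Y ⊗ₘ rptr A Z := by
  apply ext'
  simp only [rptr_def, comp_val, tens_val, idm_val, cap_val, cup_val]
  rw [← tensR_idR_idR, ← tensR_assoc, ← tensR_assoc, Nat.add_assoc n k 1, ← tensR_assoc,
    Nat.add_assoc n k 2, Nat.add_assoc n (k + 1) 1, compR_tensR_tensR ?_ ?_,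
    compR_tensR_tensR ?_ ?_, idR_compR ?_, compR_idR ?_]
  all_goals (first
    | exact Mor.respC _
    | exact Mor.respR _
    | assumption
    | (apply_rules (maxDepth := 60) [Mor.respC, Mor.respR, RespR.idR, RespC.idR, RespR.compR,
        RespC.compR, RespR.tensR, RespC.tensR, RespR.add, RespC.add, RespR.sub, RespC.sub,
        RespR.smul, RespC.smul, RespR.neg, RespC.neg, RespR.zero, RespC.zero, RespR.capR,
        RespC.capR, RespR.cupR, RespC.cupR]))

/-- Sliding a cup below a morphism: `(𝟙 ⊗ ∪) X = (X ⊗ 𝟙₂)(𝟙 ⊗ ∪)`. [folklore] -/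
theorem cup_slide (X : Mor K n n) :
    (idm n ⊗ₘ cup A :) ⊚ X = (X ⊗ₘ idm 2 :) ⊚ (idm n ⊗ₘ cup A :) := by
  apply ext'
  simp only [comp_val, tens_val, idm_val, cup_val]
  conv_lhs => rw [← tensR_idR_zero (n := n) (m := n) X.val]
  rw [compR_tensR_tensR ?_ ?_, compR_tensR_tensR ?_ ?_, idR_compR ?_, compR_idR ?_, idR_compR ?_,
    compR_idR ?_]
  all_goals (first
    | exact Mor.respC _
    | exact Mor.respR _
    | assumption
    | (apply_rules (maxDepth := 60) [Mor.respC, Mor.respR, RespR.idR, RespC.idR, RespR.compR,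
        RespC.compR, RespR.tensR, RespC.tensR, RespR.add, RespC.add, RespR.sub, RespC.sub,
        RespR.smul, RespC.smul, RespR.neg, RespC.neg, RespR.zero, RespC.zero, RespR.capR,
        RespC.capR, RespR.cupR, RespC.cupR]))

/-- Sliding a cap above a morphism: `X (𝟙 ⊗ ∩) = (𝟙 ⊗ ∩)(X ⊗ 𝟙₂)`. [folklore] -/
theorem cap_slide (X : Mor K n n) :
    X ⊚ (idm n ⊗ₘ cap A :) = (idm n ⊗ₘ cap A :) ⊚ (X ⊗ₘ idm 2 :) := by
  apply ext'
  simp only [comp_val, tens_val, idm_val, cap_val]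
  conv_lhs => rw [← tensR_idR_zero (n := n) (m := n) X.val]
  rw [compR_tensR_tensR_zero ?_ ?_, compR_tensR_tensR ?_ ?_, idR_compR ?_, compR_idR ?_,
    idR_compR ?_, compR_idR ?_]
  all_goals (first
    | exact Mor.respC _
    | exact Mor.respR _
    | assumption
    | (apply_rules (maxDepth := 60) [Mor.respC, Mor.respR, RespR.idR, RespC.idR, RespR.compR,
        RespC.compR, RespR.tensR, RespC.tensR, RespR.add, RespC.add, RespR.sub, RespC.sub,
        RespR.smul, RespC.smul, RespR.neg, RespC.neg, RespR.zero, RespC.zero, RespR.capR,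
        RespC.capR, RespR.cupR, RespC.cupR]))

/-- Bookkeeping lemma `idm_tens_U` of the binor tensor model of Temperley–Lieb recoupling theory (conventions of KL94 §8.2, §9). [folklore] -/
theorem idm_tens_U (n : ℕ) :
    (idm n ⊗ₘ U A : Mor K (n + 2) (n + 2)) = (idm n ⊗ₘ cup A :) ⊚ (idm n ⊗ₘ cap A :) := by
  rw [U, idm_tens_comp_idm_tens]

/-! #### The Jones–Wenzl induction -/

section JWStep

variable {A} {n : ℕ}

/-- `B P B = (Δ_{n+1}/Δ_n) ∪ f_n ∩` (the hook squared through the projector). [folklore] -/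
theorem jw_step_BPB (h2 : rptr A (jw A (n + 1)) = (Delta A (n + 1) / Delta A n) • jw A n) :
    (idm n ⊗ₘ U A :) ⊚ (jw A (n + 1) ⊗ₘ idm 1 :) ⊚ (idm n ⊗ₘ U A :) =
      (Delta A (n + 1) / Delta A n) •
        ((idm n ⊗ₘ cup A :) ⊚ jw A n ⊚ (idm n ⊗ₘ cap A :)) := by
  rw [idm_tens_U, ← smul_comp, ← comp_smul, ← h2, rptr_def]
  simp only [comp_assoc]

/-- `P (∪ f_n ∩) P = P B P` where `P = f_{n+1} ⊗ 𝟙`. [folklore] -/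
theorem jw_step_PcupP (h3 : jw A (n + 1) ⊚ (jw A n ⊗ₘ idm 1) = jw A (n + 1)) :
    (jw A (n + 1) ⊗ₘ idm 1 :) ⊚ ((idm n ⊗ₘ cup A :) ⊚ jw A n ⊚ (idm n ⊗ₘ cap A :)) ⊚
      (jw A (n + 1) ⊗ₘ idm 1 :) =
    (jw A (n + 1) ⊗ₘ idm 1 :) ⊚ (idm n ⊗ₘ U A :) ⊚ (jw A (n + 1) ⊗ₘ idm 1 :) := by
  rw [cup_slide, idm_tens_U]
  have hh : (jw A (n + 1) ⊗ₘ idm 1 :) ⊚ (jw A n ⊗ₘ idm 2 :) = (jw A (n + 1) ⊗ₘ idm 1 :) := by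
    rw [← tens_idm_one_idm_one, tens_idm_comp_tens_idm, h3]
  simp only [comp_assoc]
  rw [hh]

/-- One step of the Jones–Wenzl induction. [folklore] -/
theorem jw_step (hA : A ≠ 0) (h1 : jw A (n + 1) ⊚ jw A (n + 1) = jw A (n + 1))
    (h2 : rptr A (jw A (n + 1)) = (Delta A (n + 1) / Delta A n) • jw A n)
    (h3 : jw A (n + 1) ⊚ (jw A n ⊗ₘ idm 1) = jw A (n + 1))
    (hΔn : Delta A n ≠ 0) (hΔn1 : Delta A (n + 1) ≠ 0) :
    jw A (n + 2) ⊚ jw A (n + 2) = jw A (n + 2) ∧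
    rptr A (jw A (n + 2)) = (Delta A (n + 2) / Delta A (n + 1)) • jw A (n + 1) ∧
    jw A (n + 2) ⊚ (jw A (n + 1) ⊗ₘ idm 1 :) = jw A (n + 2) ∧
    (jw A (n + 1) ⊗ₘ idm 1 :) ⊚ jw A (n + 2) = jw A (n + 2) := by
  have PP : (jw A (n + 1) ⊗ₘ idm 1 :) ⊚ (jw A (n + 1) ⊗ₘ idm 1 :) = (jw A (n + 1) ⊗ₘ idm 1 :) := by
    rw [tens_idm_comp_tens_idm, h1]
  have BPB := jw_step_BPB h2
  have PcP := jw_step_PcupP h3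
  -- Q := P B P satisfies P Q = Q, Q P = Q, Q Q = (Δ_{n+1}/Δ_n) Q
  have PQ : (jw A (n + 1) ⊗ₘ idm 1 :) ⊚ ((jw A (n + 1) ⊗ₘ idm 1 :) ⊚ (idm n ⊗ₘ U A :) ⊚
      (jw A (n + 1) ⊗ₘ idm 1 :)) = (jw A (n + 1) ⊗ₘ idm 1 :) ⊚ (idm n ⊗ₘ U A :) ⊚
      (jw A (n + 1) ⊗ₘ idm 1 :) := by
    simp only [comp_assoc]; rw [PP]
  have QP : (jw A (n + 1) ⊗ₘ idm 1 :) ⊚ (idm n ⊗ₘ U A :) ⊚ (jw A (n + 1) ⊗ₘ idm 1 :) ⊚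
      (jw A (n + 1) ⊗ₘ idm 1 :) = (jw A (n + 1) ⊗ₘ idm 1 :) ⊚ (idm n ⊗ₘ U A :) ⊚
      (jw A (n + 1) ⊗ₘ idm 1 :) := by
    rw [← comp_assoc, PP]
  have QQ : ((jw A (n + 1) ⊗ₘ idm 1 :) ⊚ (idm n ⊗ₘ U A :) ⊚ (jw A (n + 1) ⊗ₘ idm 1 :)) ⊚
      ((jw A (n + 1) ⊗ₘ idm 1 :) ⊚ (idm n ⊗ₘ U A :) ⊚ (jw A (n + 1) ⊗ₘ idm 1 :)) =
      (Delta A (n + 1) / Delta A n) • ((jw A (n + 1) ⊗ₘ idm 1 :) ⊚ (idm n ⊗ₘ U A :) ⊚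
      (jw A (n + 1) ⊗ₘ idm 1 :)) := by
    simp only [comp_assoc]
    rw [QP, ← comp_assoc (jw A (n + 1) ⊗ₘ idm 1 :) (idm n ⊗ₘ U A :) (jw A (n + 1) ⊗ₘ idm 1 :),
      ← comp_assoc (jw A (n + 1) ⊗ₘ idm 1 :) ((idm n ⊗ₘ U A :) ⊚ (jw A (n + 1) ⊗ₘ idm 1 :))
        (idm n ⊗ₘ U A :), BPB, comp_smul, smul_comp, PcP]
    simp only [comp_assoc]
  have hcc' : Delta A n / Delta A (n + 1) * (Delta A (n + 1) / Delta A n) = 1 := by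
    field_simp
  rw [jw_succ_succ]
  refine ⟨?_, ?_, ?_, ?_⟩
  · -- idempotency
    rw [sub_comp, comp_sub, comp_sub, PP, comp_smul, PQ, smul_comp, smul_comp, QP, comp_smul, QQ,
      smul_smul, smul_smul, mul_assoc, hcc', mul_one, sub_self, sub_zero]
  · -- partial trace
    rw [rptr_sub, rptr_smul, rptr_tens_idm_one, rptr_sandwich, rptr_tens, rptr_U A hA, idm_tens_idm,
      comp_idm, h1, Delta_succ_succ, ← sub_smul]
    congr 1
    field_simp
  · rw [sub_comp, PP, smul_comp, QP]
  · rw [comp_sub, PP, comp_smul, PQ]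

/-- The Jones–Wenzl package: `f_{n+1}` is idempotent, its partial trace is `(Δ_{n+1}/Δ_n) f_n`, and it
absorbs `f_n ⊗ 𝟙` on both sides — provided `Δ_0, …, Δ_n ≠ 0`.
[cite: KauffmanLins1994, §3.1 Lemma 1, §3.3, §9.8] -/
theorem jw_package (hA : A ≠ 0) : ∀ n : ℕ, (∀ i ≤ n, Delta A i ≠ 0) →
    jw A (n + 1) ⊚ jw A (n + 1) = jw A (n + 1) ∧
    rptr A (jw A (n + 1)) = (Delta A (n + 1) / Delta A n) • jw A n ∧
    jw A (n + 1) ⊚ (jw A n ⊗ₘ idm 1) = jw A (n + 1) ∧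
    (jw A n ⊗ₘ idm 1) ⊚ jw A (n + 1) = jw A (n + 1) := by
  intro n
  induction n with
  | zero =>
    intro _
    have e : (idm 0 ⊗ₘ idm 1 : Mor K (0 + 1) (0 + 1)) = idm 1 := idm_tens_idm 0 1
    rw [jw_one, jw_zero]
    refine ⟨idm_comp _, ?_, ?_, ?_⟩
    · rw [show (idm 1 : Mor K 1 1) = idm 0 ⊗ₘ idm 1 from e.symm, rptr_tens_idm_one]
      simp
    · rw [e, idm_comp]
    · rw [e, idm_comp]
  | succ n ih =>
    intro hΔ
    have ih' := ih (fun i hi => hΔ i (Nat.le_succ_of_le hi))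
    exact jw_step hA ih'.1 ih'.2.1 ih'.2.2.1 (hΔ n (Nat.le_succ n)) (hΔ (n + 1) le_rfl)

end JWStep

/-! #### Consequences: absorption, trace, annihilation of cups and caps -/


variable {A}

/-- Bookkeeping lemma `jw_idem` of the binor tensor model of Temperley–Lieb recoupling theory (conventions of KL94 §8.2, §9). [folklore] -/
theorem jw_idem (hA : A ≠ 0) (hg : Good A (n + 1)) : jw A (n + 1) ⊚ jw A (n + 1) = jw A (n + 1) :=
  (jw_package hA n (fun i hi => hg i (Nat.lt_succ_of_le hi))).1

/-- Bookkeeping lemma `jw_idem'` of the binor tensor model of Temperley–Lieb recoupling theory (conventions of KL94 §8.2, §9). [folklore] -/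
theorem jw_idem' (hA : A ≠ 0) (hg : Good A n) : jw A n ⊚ jw A n = jw A n := by
  cases n with
  | zero => rw [jw_zero, idm_comp]
  | succ n => exact jw_idem hA hg

/-- Bookkeeping lemma `rptr_jw` of the binor tensor model of Temperley–Lieb recoupling theory (conventions of KL94 §8.2, §9). [folklore] -/
theorem rptr_jw (hA : A ≠ 0) (hg : Good A (n + 1)) :
    rptr A (jw A (n + 1)) = (Delta A (n + 1) / Delta A n) • jw A n :=
  (jw_package hA n (fun i hi => hg i (Nat.lt_succ_of_le hi))).2.1

/-- Bookkeeping lemma `jw_absorb_right` of the binor tensor model of Temperley–Lieb recoupling theory (conventions of KL94 §8.2, §9). [folklore] -/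
theorem jw_absorb_right (hA : A ≠ 0) (hg : Good A (n + 1)) :
    jw A (n + 1) ⊚ (jw A n ⊗ₘ idm 1) = jw A (n + 1) :=
  (jw_package hA n (fun i hi => hg i (Nat.lt_succ_of_le hi))).2.2.1

/-- Bookkeeping lemma `jw_absorb_left` of the binor tensor model of Temperley–Lieb recoupling theory (conventions of KL94 §8.2, §9). [folklore] -/
theorem jw_absorb_left (hA : A ≠ 0) (hg : Good A (n + 1)) :
    (jw A n ⊗ₘ idm 1) ⊚ jw A (n + 1) = jw A (n + 1) :=
  (jw_package hA n (fun i hi => hg i (Nat.lt_succ_of_le hi))).2.2.2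

/-- Bookkeeping lemma `tens_idm_succ` of the binor tensor model of Temperley–Lieb recoupling theory (conventions of KL94 §8.2, §9). [folklore] -/
theorem tens_idm_succ (X : Mor K m n) (j : ℕ) : X ⊗ₘ idm (j + 1) = X ⊗ₘ idm j ⊗ₘ idm 1 := by
  apply ext'
  simp only [tens_val, idm_val]
  rw [← tensR_assoc, tensR_idR_idR]

/-- General absorption `f_{k+j} (f_k ⊗ 𝟙_j) = f_{k+j}`. [cite: KauffmanLins1994, §3.1] -/
theorem jw_absorb_right' (hA : A ≠ 0) {k : ℕ} : ∀ j : ℕ, Good A (k + j) →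
    jw A (k + j) ⊚ (jw A k ⊗ₘ idm j) = jw A (k + j) := by
  intro j
  induction j with
  | zero => intro hg; rw [tens_idm_zero]; exact jw_idem' hA hg
  | succ j ih =>
    intro hg
    show jw A (k + j + 1) ⊚ (jw A k ⊗ₘ idm (j + 1) :) = jw A (k + j + 1)
    rw [← jw_absorb_right (n := k + j) hA hg, tens_idm_succ (jw A k) j, ← comp_assoc,
      tens_idm_comp_tens_idm, ih (hg.mono (Nat.le_succ _))]

/-- General absorption `(f_k ⊗ 𝟙_j) f_{k+j} = f_{k+j}`. [cite: KauffmanLins1994, §3.1] -/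
theorem jw_absorb_left' (hA : A ≠ 0) {k : ℕ} : ∀ j : ℕ, Good A (k + j) →
    (jw A k ⊗ₘ idm j) ⊚ jw A (k + j) = jw A (k + j) := by
  intro j
  induction j with
  | zero => intro hg; rw [tens_idm_zero]; exact jw_idem' hA hg
  | succ j ih =>
    intro hg
    show (jw A k ⊗ₘ idm (j + 1) :) ⊚ jw A (k + j + 1) = jw A (k + j + 1)
    rw [← jw_absorb_left (n := k + j) hA hg, tens_idm_succ (jw A k) j, comp_assoc,
      tens_idm_comp_tens_idm, ih (hg.mono (Nat.le_succ _))]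


/-- `tr f_n = Δ_n`. [cite: KauffmanLins1994, §3.1 Lemma 1 (iii), §9.3] -/
theorem trAll_jw (hA : A ≠ 0) : ∀ n : ℕ, Good A n → trAll A (jw A n) = Delta A n := by
  intro n
  induction n with
  | zero => intro _; rw [jw_zero, trAll_idm_zero, Delta_zero]
  | succ n ih =>
    intro hg
    rw [trAll_succ, rptr_jw hA hg, trAll_smul, ih (hg.mono (Nat.le_succ _)),
      div_mul_cancel₀ _ (hg n (Nat.lt_succ_self n))]

/-! #### Three-block raw calculus -/

end Mor


/-- Bookkeeping lemma `block_respR` of the binor tensor model of Temperley–Lieb recoupling theory (conventions of KL94 §8.2, §9). [folklore] -/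
theorem block_respR {i a b j : ℕ} {X : Raw K} (hX : RespR a X) : RespR (i + a + j) (block i X a b j) := by
  unfold block; (first
    | exact Mor.respC _
    | exact Mor.respR _
    | assumption
    | (apply_rules (maxDepth := 60) [Mor.respC, Mor.respR, RespR.idR, RespC.idR, RespR.compR,
        RespC.compR, RespR.tensR, RespC.tensR, RespR.add, RespC.add, RespR.sub, RespC.sub,
        RespR.smul, RespC.smul, RespR.neg, RespC.neg, RespR.zero, RespC.zero, RespR.capR,
        RespC.capR, RespR.cupR, RespC.cupR]))

/-- Bookkeeping lemma `block_respC` of the binor tensor model of Temperley–Lieb recoupling theory (conventions of KL94 §8.2, §9). [folklore] -/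
theorem block_respC {i a b j : ℕ} {X : Raw K} (hX : RespC b X) : RespC (i + b + j) (block i X a b j) := by
  unfold block; (first
    | exact Mor.respC _
    | exact Mor.respR _
    | assumption
    | (apply_rules (maxDepth := 60) [Mor.respC, Mor.respR, RespR.idR, RespC.idR, RespR.compR,
        RespC.compR, RespR.tensR, RespC.tensR, RespR.add, RespC.add, RespR.sub, RespC.sub,
        RespR.smul, RespC.smul, RespR.neg, RespC.neg, RespR.zero, RespC.zero, RespR.capR,
        RespC.capR, RespR.cupR, RespC.cupR]))

/-- Bookkeeping lemma `block_compR` of the binor tensor model of Temperley–Lieb recoupling theory (conventions of KL94 §8.2, §9). [folklore] -/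
theorem block_compR {i a b c j : ℕ} {X Y : Raw K} (hX : RespC b X) (hY : RespR b Y) :
    compR (i + b + j) (block i X a b j) (block i Y b c j) = block i (compR b X Y) a c j := by
  unfold block
  rw [compR_tensR_tensR ?_ ?_, compR_tensR_tensR ?_ ?_, idR_compR ?_, idR_compR ?_]
  all_goals (first
    | exact Mor.respC _
    | exact Mor.respR _
    | assumption
    | (apply_rules (maxDepth := 60) [Mor.respC, Mor.respR, RespR.idR, RespC.idR, RespR.compR,
        RespC.compR, RespR.tensR, RespC.tensR, RespR.add, RespC.add, RespR.sub, RespC.sub,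
        RespR.smul, RespC.smul, RespR.neg, RespC.neg, RespR.zero, RespC.zero, RespR.capR,
        RespC.capR, RespR.cupR, RespC.cupR]))

/-- Bookkeeping lemma `block_succ_right` of the binor tensor model of Temperley–Lieb recoupling theory (conventions of KL94 §8.2, §9). [folklore] -/
theorem block_succ_right (i a b j : ℕ) (X : Raw K) :
    block i X a b (1 + j) = block i (tensR a b X (idR 1)) (a + 1) (b + 1) j := by
  unfold block
  rw [← tensR_idR_idR 1 j, tensR_assoc, ← tensR_assoc (n := i), Nat.add_assoc, Nat.add_assoc]

/-- Bookkeeping lemma `block_succ_left` of the binor tensor model of Temperley–Lieb recoupling theory (conventions of KL94 §8.2, §9). [folklore] -/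
theorem block_succ_left (i a b j : ℕ) (X : Raw K) :
    block (i + 1) X a b j = block i (tensR 1 1 (idR 1) X) (1 + a) (1 + b) j := by
  unfold block
  rw [← tensR_idR_idR i 1, ← tensR_assoc (n := i), Nat.add_assoc, Nat.add_assoc]

/-- Bookkeeping lemma `block_idR` of the binor tensor model of Temperley–Lieb recoupling theory (conventions of KL94 §8.2, §9). [folklore] -/
theorem block_idR (i a j : ℕ) : block i (idR (K := K) a) a a j = idR (i + a + j) := by
  unfold block
  rw [tensR_idR_idR, tensR_idR_idR]

/-- Bookkeeping lemma `block_tensR_idR` of the binor tensor model of Temperley–Lieb recoupling theory (conventions of KL94 §8.2, §9). [folklore] -/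
theorem block_tensR_idR (i a b j k : ℕ) (X : Raw K) :
    tensR (i + a + j) (i + b + j) (block i X a b j) (idR k) = block i X a b (j + k) := by
  unfold block
  rw [← tensR_assoc, tensR_idR_idR]

/-- Bookkeeping lemma `idR_tensR_block` of the binor tensor model of Temperley–Lieb recoupling theory (conventions of KL94 §8.2, §9). [folklore] -/
theorem idR_tensR_block (k i a b j : ℕ) (X : Raw K) :
    tensR k k (idR k) (block i X a b j) = block (k + i) X a b j := by
  unfold block
  rw [tensR_assoc, tensR_assoc, tensR_idR_idR, Nat.add_assoc, Nat.add_assoc]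

/-- Bookkeeping lemma `block_eq` of the binor tensor model of Temperley–Lieb recoupling theory (conventions of KL94 §8.2, §9). [folklore] -/
theorem block_eq (i a b j : ℕ) (X : Raw K) : block i X a b j = tensR i i (idR i) (block 0 X a b j) := by
  rw [idR_tensR_block, Nat.add_zero]

/-- Bookkeeping lemma `block_smul` of the binor tensor model of Temperley–Lieb recoupling theory (conventions of KL94 §8.2, §9). [folklore] -/
theorem block_smul (i a b j : ℕ) (c : K) (X : Raw K) : block i (c • X) a b j = c • block i X a b j := by
  unfold block
  rw [tensR_smul, smul_tensR]

/-- Bookkeeping lemma `block_add` of the binor tensor model of Temperley–Lieb recoupling theory (conventions of KL94 §8.2, §9). [folklore] -/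
theorem block_add (i a b j : ℕ) (X Y : Raw K) : block i (X + Y) a b j = block i X a b j + block i Y a b j := by
  unfold block
  rw [tensR_add, add_tensR]

/-- Bookkeeping lemma `block_zero` of the binor tensor model of Temperley–Lieb recoupling theory (conventions of KL94 §8.2, §9). [folklore] -/
@[simp] theorem block_zero (i a b j : ℕ) : block i (0 : Raw K) a b j = 0 := by
  unfold block; simp

/-- Bookkeeping lemma `block_zero_left` of the binor tensor model of Temperley–Lieb recoupling theory (conventions of KL94 §8.2, §9). [folklore] -/
theorem block_zero_left (X : Raw K) (a b j : ℕ) : block 0 X a b j = tensR a b X (idR j) := by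
  unfold block
  rw [tensR_zero_zero_idR_zero, Nat.zero_add, Nat.zero_add]

namespace Mor

/-! #### Positional cups, caps and hooks (level-indexed), local relations -/

variable (A : K)


/-- Bookkeeping lemma `cupAt_val` of the binor tensor model of Temperley–Lieb recoupling theory (conventions of KL94 §8.2, §9). [folklore] -/
theorem cupAt_val {n i : ℕ} (h : i ≤ n) : (cupAt A n i).val = block i (cupR A) 2 0 (n - i) := by
  rw [cupAt, dif_pos h]; rfl

/-- Bookkeeping lemma `capAt_val` of the binor tensor model of Temperley–Lieb recoupling theory (conventions of KL94 §8.2, §9). [folklore] -/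
theorem capAt_val {n i : ℕ} (h : i ≤ n) : (capAt A n i).val = block i (capR A) 0 2 (n - i) := by
  rw [capAt, dif_pos h]; rfl

/-- Bookkeeping lemma `cupAt_of_gt` of the binor tensor model of Temperley–Lieb recoupling theory (conventions of KL94 §8.2, §9). [folklore] -/
theorem cupAt_of_gt {n i : ℕ} (h : n < i) : cupAt A n i = 0 := by
  rw [cupAt, dif_neg (by omega)]

/-- Bookkeeping lemma `capAt_of_gt` of the binor tensor model of Temperley–Lieb recoupling theory (conventions of KL94 §8.2, §9). [folklore] -/
theorem capAt_of_gt {n i : ℕ} (h : n < i) : capAt A n i = 0 := by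
  rw [capAt, dif_neg (by omega)]

/-- `∩_i ∪_i = d`. [folklore] -/
theorem capAt_cupAt_same {n i : ℕ} (h : i ≤ n) : capAt A n i ⊚ cupAt A n i = dval A • idm n := by
  apply ext'
  rw [comp_val, capAt_val A h, cupAt_val A h, smul_val, idm_val,
    show n + 2 = i + 2 + (n - i) by omega, block_compR ?_ ?_, capR_cupR, block_smul, block_idR,
    show i + 0 + (n - i) = n by omega]
  all_goals (first
    | exact Mor.respC _
    | exact Mor.respR _
    | assumption
    | (apply_rules (maxDepth := 60) [Mor.respC, Mor.respR, RespR.idR, RespC.idR, RespR.compR,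
        RespC.compR, RespR.tensR, RespC.tensR, RespR.add, RespC.add, RespR.sub, RespC.sub,
        RespR.smul, RespC.smul, RespR.neg, RespC.neg, RespR.zero, RespC.zero, RespR.capR,
        RespC.capR, RespR.cupR, RespC.cupR]))

/-- `∩_i ∪_{i+1} = 𝟙`. [folklore] -/
theorem capAt_cupAt_succ (hA : A ≠ 0) {n i : ℕ} (h : i + 1 ≤ n) :
    capAt A n i ⊚ cupAt A n (i + 1) = idm n := by
  apply ext'
  rw [comp_val, capAt_val A (by omega), cupAt_val A h, idm_val,
    show n - i = 1 + (n - (i + 1)) by omega, block_succ_right, block_succ_left]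
  simp only [Nat.reduceAdd]
  rw [show n + 2 = i + 3 + (n - (i + 1)) by omega,
    block_compR (RespC.tensR (RespC.capR A) (RespC.idR 1) 0) (RespR.tensR (RespR.idR 1) (RespR.cupR A) 1),
    zigzagR_right A hA, block_idR, show i + 1 + (n - (i + 1)) = n by omega]

/-- `∩_{i+1} ∪_i = 𝟙`. [folklore] -/
theorem capAt_succ_cupAt (hA : A ≠ 0) {n i : ℕ} (h : i + 1 ≤ n) :
    capAt A n (i + 1) ⊚ cupAt A n i = idm n := by
  apply ext'
  rw [comp_val, capAt_val A h, cupAt_val A (by omega), idm_val,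
    show n - i = 1 + (n - (i + 1)) by omega, block_succ_right, block_succ_left]
  simp only [Nat.reduceAdd]
  rw [show n + 2 = i + 3 + (n - (i + 1)) by omega,
    block_compR (RespC.tensR (RespC.idR 1) (RespC.capR A) 1) (RespR.tensR (RespR.cupR A) (RespR.idR 1) 0),
    zigzagR_left A hA, block_idR, show i + 1 + (n - (i + 1)) = n by omega]

/-- Far commutation `∩_i ∪_{i'} = ∪_{i'-2} ∩_i` for `i + 2 ≤ i'`. [folklore] -/
theorem capAt_cupAt_far {n i i' : ℕ} (hii' : i + 2 ≤ i') (hi' : i' ≤ n + 2) :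
    capAt A (n + 2) i ⊚ cupAt A (n + 2) i' = cupAt A n (i' - 2) ⊚ capAt A n i := by
  obtain ⟨g, rfl⟩ : ∃ g, i' = i + 2 + g := ⟨i' - i - 2, by omega⟩
  apply ext'
  rw [comp_val, comp_val, capAt_val A (by omega), cupAt_val A hi', cupAt_val A (by omega),
    capAt_val A (by omega), show i + 2 + g - 2 = i + g by omega,
    show n + 2 - (i + 2 + g) = n - i - g by omega, show n - (i + g) = n - i - g by omega]
  -- the common right factor
  have hW : RespR (g + 2 + (n - i - g)) (block g (cupR A) 2 0 (n - i - g)) := block_respR (RespR.cupR A)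
  -- left-hand side
  rw [block_eq (i := i) (X := capR A), show i + 2 + g = i + (2 + g) by omega, ← idR_tensR_block i (2 + g),
    ← idR_tensR_block 2 g, block_zero_left, show n + 2 + 2 = i + (2 + (g + 2 + (n - i - g))) by omega,
    compR_tensR_tensR (RespC.idR i) (RespR.idR i), idR_compR (RespR.idR i),
    show n + 2 - i = g + 2 + (n - i - g) by omega,
    compR_tensR_tensR (RespC.capR A) (RespR.idR 2), compR_idR (RespC.capR A), idR_compR hW]
  -- right-hand side
  rw [block_eq (i := i) (X := capR A), ← idR_tensR_block i g, block_zero_left,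
    show (compR n : Raw K → Raw K → Raw K) = compR (i + (n - i)) by rw [Nat.add_sub_cancel' (by omega)],
    compR_tensR_tensR (RespC.idR i) (RespR.idR i), idR_compR (RespR.idR i)]
  have hWc : RespC (n - i) (block g (cupR A) 2 0 (n - i - g)) := by
    have := block_respC (i := g) (a := 2) (j := n - i - g) (RespC.cupR A 0)
    rwa [show g + 0 + (n - i - g) = n - i by omega] at this
  conv_rhs => rw [← tensR_zero_zero_idR_zero (block g (cupR A) 2 0 (n - i - g)),
    show (compR (n - i) : Raw K → Raw K → Raw K) = compR (0 + (n - i)) by rw [Nat.zero_add],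
    compR_tensR_tensR (RespC.idR 0) (RespR.capR A 0), idR_compR (RespR.capR A 0), compR_idR hWc]

-- (`cast_val_eq`, a duplicate of `cast_val`, was removed here; numbering preserved)


/-- Adding a strand on the right of a positional cup. [folklore] -/
theorem cupAt_succ {n i : ℕ} (h : i ≤ n) : cupAt A (n + 1) i = (cupAt A n i ⊗ₘ idm 1 :) := by
  apply ext'
  rw [tens_val, cupAt_val A h, cupAt_val A (by omega), idm_val, show n + 1 - i = (n - i) + 1 by omega,
    ← block_tensR_idR]
  congr 1 <;> omega

/-- Adding a strand on the right of a positional cap. [folklore] -/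
theorem capAt_succ {n i : ℕ} (h : i ≤ n) : capAt A (n + 1) i = (capAt A n i ⊗ₘ idm 1 :) := by
  apply ext'
  rw [tens_val, capAt_val A h, capAt_val A (by omega), idm_val, show n + 1 - i = (n - i) + 1 by omega,
    ← block_tensR_idR]
  congr 1 <;> omega

/-- Bookkeeping lemma `cupAt_add_val` of the binor tensor model of Temperley–Lieb recoupling theory (conventions of KL94 §8.2, §9). [folklore] -/
theorem cupAt_add_val {n i : ℕ} (h : i ≤ n) (k : ℕ) :
    (cupAt A n i ⊗ₘ idm k).val = (cupAt A (n + k) i).val := by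
  rw [tens_val, cupAt_val A h, cupAt_val A (by omega), idm_val, show n + k - i = (n - i) + k by omega,
    ← block_tensR_idR]
  congr 1 <;> omega

/-- Bookkeeping lemma `capAt_add_val` of the binor tensor model of Temperley–Lieb recoupling theory (conventions of KL94 §8.2, §9). [folklore] -/
theorem capAt_add_val {n i : ℕ} (h : i ≤ n) (k : ℕ) :
    (capAt A n i ⊗ₘ idm k).val = (capAt A (n + k) i).val := by
  rw [tens_val, capAt_val A h, capAt_val A (by omega), idm_val, show n + k - i = (n - i) + k by omega,
    ← block_tensR_idR]
  congr 1 <;> omega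

/-- Bookkeeping lemma `idm_tens_cupAt_val` of the binor tensor model of Temperley–Lieb recoupling theory (conventions of KL94 §8.2, §9). [folklore] -/
theorem idm_tens_cupAt_val (k : ℕ) {n i : ℕ} (h : i ≤ n) :
    (idm k ⊗ₘ cupAt A n i).val = (cupAt A (k + n) (k + i)).val := by
  rw [tens_val, cupAt_val A h, cupAt_val A (by omega), idm_val, idR_tensR_block]
  congr 1; omega

/-- Bookkeeping lemma `idm_tens_capAt_val` of the binor tensor model of Temperley–Lieb recoupling theory (conventions of KL94 §8.2, §9). [folklore] -/
theorem idm_tens_capAt_val (k : ℕ) {n i : ℕ} (h : i ≤ n) :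
    (idm k ⊗ₘ capAt A n i).val = (capAt A (k + n) (k + i)).val := by
  rw [tens_val, capAt_val A h, capAt_val A (by omega), idm_val, idR_tensR_block]
  congr 1; omega

/-- Bookkeeping lemma `cupAt_last` of the binor tensor model of Temperley–Lieb recoupling theory (conventions of KL94 §8.2, §9). [folklore] -/
theorem cupAt_last (n : ℕ) : cupAt A n n = (idm n ⊗ₘ cup A :).cast rfl rfl := by
  apply ext'
  rw [cupAt_val A le_rfl, cast_val, tens_val, idm_val, cup_val, Nat.sub_self]
  unfold block
  rw [tensR_idR_zero]

/-- Bookkeeping lemma `capAt_last` of the binor tensor model of Temperley–Lieb recoupling theory (conventions of KL94 §8.2, §9). [folklore] -/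
theorem capAt_last (n : ℕ) : capAt A n n = (idm n ⊗ₘ cap A :).cast rfl rfl := by
  apply ext'
  rw [capAt_val A le_rfl, cast_val, tens_val, idm_val, cap_val, Nat.sub_self]
  unfold block
  rw [tensR_idR_zero]

/-- Bookkeeping lemma `trpm_cupAt` of the binor tensor model of Temperley–Lieb recoupling theory (conventions of KL94 §8.2, §9). [folklore] -/
theorem trpm_cupAt (n i : ℕ) : trpm (cupAt A n i) = -capAt A n i := by
  by_cases h : i ≤ n
  · apply ext'
    rw [trpm_val, cupAt_val A h, neg_val, capAt_val A h]
    unfold block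
    rw [trp_tensR, trp_tensR, trp_idR, trp_idR, trp_cupR,
      show -capR A = (-1 : K) • capR A by simp, tensR_smul, smul_tensR]
    simp
  · rw [cupAt_of_gt A (by omega), capAt_of_gt A (by omega), trpm_zero, neg_zero]

/-- Bookkeeping lemma `trpm_capAt` of the binor tensor model of Temperley–Lieb recoupling theory (conventions of KL94 §8.2, §9). [folklore] -/
theorem trpm_capAt (n i : ℕ) : trpm (capAt A n i) = -cupAt A n i := by
  by_cases h : i ≤ n
  · apply ext'
    rw [trpm_val, capAt_val A h, neg_val, cupAt_val A h]
    unfold block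
    rw [trp_tensR, trp_tensR, trp_idR, trp_idR, trp_capR,
      show -cupR A = (-1 : K) • cupR A by simp, tensR_smul, smul_tensR]
    simp
  · rw [cupAt_of_gt A (by omega), capAt_of_gt A (by omega), trpm_zero, neg_zero]

/-- Bookkeeping lemma `neg_comp` of the binor tensor model of Temperley–Lieb recoupling theory (conventions of KL94 §8.2, §9). [folklore] -/
theorem neg_comp (X : Mor K n p) (Y : Mor K m n) : (-X) ⊚ Y = -(X ⊚ Y) := by
  rw [← neg_one_smul K X, smul_comp, neg_one_smul]

/-- Bookkeeping lemma `comp_neg` of the binor tensor model of Temperley–Lieb recoupling theory (conventions of KL94 §8.2, §9). [folklore] -/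
theorem comp_neg (X : Mor K n p) (Y : Mor K m n) : X ⊚ (-Y) = -(X ⊚ Y) := by
  rw [← neg_one_smul K Y, comp_smul, neg_one_smul]

/-- Far commutation `∩_{i'} ∪_i = ∪_i ∩_{i'-2}` for `i + 2 ≤ i'`. [folklore] -/
theorem capAt_cupAt_far' {n i i' : ℕ} (hii' : i + 2 ≤ i') (hi' : i' ≤ n + 2) :
    capAt A (n + 2) i' ⊚ cupAt A (n + 2) i = cupAt A n i ⊚ capAt A n (i' - 2) := by
  have h := congrArg trpm (capAt_cupAt_far A hii' hi')
  rw [trpm_comp, trpm_comp, trpm_cupAt, trpm_capAt, trpm_cupAt, trpm_capAt, neg_comp, comp_neg,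
    neg_comp, comp_neg, neg_neg, neg_neg] at h
  exact h

end Mor

namespace Mor

variable {A : K}

/-- `f_{i+2}` kills a cup on its last two strands. [cite: KauffmanLins1994, §3.1 Lemma 1 (ii)] -/
theorem jw_comp_cup_last (hA : A ≠ 0) {i : ℕ} (hg : Good A (i + 2)) :
    jw A (i + 2) ⊚ (idm i ⊗ₘ cup A :) = 0 := by
  have hΔi : Delta A i ≠ 0 := hg i (by omega)
  have hΔi1 : Delta A (i + 1) ≠ 0 := hg (i + 1) (by omega)
  have hg1 : Good A (i + 1) := hg.mono (Nat.le_succ _)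
  have h2 := rptr_jw hA hg1
  have h3 := jw_absorb_right hA hg1
  have hh : (jw A (i + 1) ⊗ₘ idm 1 :) ⊚ (jw A i ⊗ₘ idm 2 :) = (jw A (i + 1) ⊗ₘ idm 1 :) := by
    rw [← tens_idm_one_idm_one, tens_idm_comp_tens_idm, h3]
  -- B P cup' = (Δ_{i+1}/Δ_i) (f_i ⊗ 𝟙₂) cup'
  have hB : (idm i ⊗ₘ U A :) ⊚ (jw A (i + 1) ⊗ₘ idm 1 :) ⊚ (idm i ⊗ₘ cup A :) =
      (Delta A (i + 1) / Delta A i) • ((jw A i ⊗ₘ idm 2 :) ⊚ (idm i ⊗ₘ cup A :)) := by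
    rw [idm_tens_U, ← cup_slide, ← comp_smul, ← h2, rptr_def]
    apply ext'
    simp only [comp_val, compR_assoc]
  have key : (jw A (i + 1) ⊗ₘ idm 1 :) ⊚ (idm i ⊗ₘ U A :) ⊚ (jw A (i + 1) ⊗ₘ idm 1 :) ⊚
      (idm i ⊗ₘ cup A :) =
      (Delta A (i + 1) / Delta A i) • ((jw A (i + 1) ⊗ₘ idm 1 :) ⊚ (idm i ⊗ₘ cup A :)) := by
    have e1 : (jw A (i + 1) ⊗ₘ idm 1 :) ⊚ (idm i ⊗ₘ U A :) ⊚ (jw A (i + 1) ⊗ₘ idm 1 :) ⊚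
        (idm i ⊗ₘ cup A :) = (jw A (i + 1) ⊗ₘ idm 1 :) ⊚ ((idm i ⊗ₘ U A :) ⊚
        (jw A (i + 1) ⊗ₘ idm 1 :) ⊚ (idm i ⊗ₘ cup A :)) := by
      apply ext'
      simp only [comp_val, compR_assoc]
    rw [e1, hB, comp_smul, comp_assoc, hh]
  rw [jw_succ_succ, sub_comp, smul_comp, key, smul_smul, div_mul_div_comm, mul_comm (Delta A i),
    div_self (mul_ne_zero hΔi1 hΔi), one_smul, sub_self]

/-- `f_{n+2}` kills every cup: `f_{n+2} ∪_i = 0` (`i ≤ n`). [cite: KauffmanLins1994, §3.1 Lemma 1 (ii)] -/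
theorem jw_comp_cupAt (hA : A ≠ 0) : ∀ {n i : ℕ}, Good A (n + 2) → i ≤ n →
    jw A (n + 2) ⊚ cupAt A n i = 0 := by
  intro n
  induction n with
  | zero =>
    intro i hg hi
    obtain rfl : i = 0 := by omega
    rw [cupAt_last]
    exact jw_comp_cup_last hA hg
  | succ n ih =>
    intro i hg hi
    rcases Nat.lt_or_ge i (n + 1) with h | h
    · rw [cupAt_succ A (by omega), ← jw_absorb_right (n := n + 2) hA hg, ← comp_assoc,
        tens_idm_comp_tens_idm, ih (hg.mono (by omega)) (by omega), zero_tens, comp_zero]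
    · obtain rfl : i = n + 1 := by omega
      rw [cupAt_last]
      exact jw_comp_cup_last hA hg

/-- `f_{n+2}` kills every hook: `f_{n+2} U_i = 0`. [cite: KauffmanLins1994, §3.1 Lemma 1 (ii)] -/
theorem jw_comp_UAt (hA : A ≠ 0) {n i : ℕ} (hg : Good A (n + 2)) (hi : i ≤ n) :
    jw A (n + 2) ⊚ UAt A n i = 0 := by
  rw [UAt, comp_assoc, jw_comp_cupAt hA hg hi, zero_comp]

/-- The Jones–Wenzl projectors are symmetric under the up–down mirror. [cite: KauffmanLins1994, §3.2] -/
theorem trpm_jw : ∀ n : ℕ, trpm (jw A n) = jw A n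
  | 0 => by rw [jw_zero, trpm_idm]
  | 1 => by rw [jw_one, trpm_idm]
  | n + 2 => by
    rw [jw_succ_succ, trpm_sub, trpm_smul, trpm_comp, trpm_comp, trpm_tens, trpm_tens, trpm_jw (n + 1),
      trpm_idm, trpm_idm, U, trpm_comp, trpm_cap, trpm_cup, neg_comp, comp_neg, neg_neg, ← comp_assoc]

/-- Every cap kills `f_{n+2}` from above: `∩_i f_{n+2} = 0`. [cite: KauffmanLins1994, §3.1 Lemma 1 (ii)] -/
theorem capAt_comp_jw (hA : A ≠ 0) {n i : ℕ} (hg : Good A (n + 2)) (hi : i ≤ n) :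
    capAt A n i ⊚ jw A (n + 2) = 0 := by
  have h := congrArg trpm (jw_comp_cupAt hA hg hi)
  rw [trpm_comp, trpm_cupAt, trpm_jw, neg_comp, trpm_zero, neg_eq_zero] at h
  exact h

/-- Bookkeeping lemma `UAt_comp_jw` of the binor tensor model of Temperley–Lieb recoupling theory (conventions of KL94 §8.2, §9). [folklore] -/
theorem UAt_comp_jw (hA : A ≠ 0) {n i : ℕ} (hg : Good A (n + 2)) (hi : i ≤ n) :
    UAt A n i ⊚ jw A (n + 2) = 0 := by
  rw [UAt, ← comp_assoc, capAt_comp_jw hA hg hi, comp_zero]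

end Mor

namespace IsTL

variable {A : K}

/-- Bookkeeping lemma `of_eq` of the binor tensor model of Temperley–Lieb recoupling theory (conventions of KL94 §8.2, §9). [folklore] -/
theorem of_eq {X Y : Mor K m n} (h : X = Y) (hX : IsTL A X) : IsTL A Y := h ▸ hX

/-- Bookkeeping lemma `neg` of the binor tensor model of Temperley–Lieb recoupling theory (conventions of KL94 §8.2, §9). [folklore] -/
theorem neg {X : Mor K m n} (hX : IsTL A X) : IsTL A (-X) := by
  rw [← neg_one_smul K X]; exact hX.smul _ _

/-- Bookkeeping lemma `sub` of the binor tensor model of Temperley–Lieb recoupling theory (conventions of KL94 §8.2, §9). [folklore] -/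
theorem sub {X Y : Mor K m n} (hX : IsTL A X) (hY : IsTL A Y) : IsTL A (X - Y) := by
  rw [sub_eq_add_neg]; exact hX.add _ _ hY.neg

/-- Bookkeeping lemma `sum` of the binor tensor model of Temperley–Lieb recoupling theory (conventions of KL94 §8.2, §9). [folklore] -/
theorem sum {ι : Type*} (S : Finset ι) {X : ι → Mor K m n} (h : ∀ i ∈ S, IsTL A (X i)) :
    IsTL A (∑ i ∈ S, X i) := by
  induction S using Finset.cons_induction with
  | empty => rw [Finset.sum_empty]; exact IsTL.zero
  | cons a S ha ih =>
    rw [Finset.sum_cons]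
    exact IsTL.add _ _ (h a (Finset.mem_cons_self a S)) (ih (fun i hi => h i (Finset.mem_cons_of_mem hi)))

/-- Closure under composition. [folklore] -/
theorem comp {X : Mor K n p} (hX : IsTL A X) : ∀ {m : ℕ} (Y : Mor K m n), IsTL A Y → IsTL A (X ⊚ Y) := by
  induction hX with
  | idm => intro m Y hY; rw [idm_comp]; exact hY
  | cup_comp i hi X _ ih => intro m Y hY; rw [← comp_assoc]; exact IsTL.cup_comp i hi _ (ih Y hY)
  | cap_comp i hi X _ ih => intro m Y hY; rw [← comp_assoc]; exact IsTL.cap_comp i hi _ (ih Y hY)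
  | zero => intro m Y _; rw [zero_comp]; exact IsTL.zero
  | add X X' _ _ ih ih' => intro m Y hY; rw [add_comp]; exact IsTL.add _ _ (ih Y hY) (ih' Y hY)
  | smul c X _ ih => intro m Y hY; rw [smul_comp]; exact IsTL.smul c _ (ih Y hY)

/-- Bookkeeping lemma `cupAt` of the binor tensor model of Temperley–Lieb recoupling theory (conventions of KL94 §8.2, §9). [folklore] -/
theorem cupAt (n i : ℕ) : IsTL A (Mor.cupAt A n i) := by
  by_cases hi : i ≤ n
  · have := IsTL.cup_comp i hi _ (IsTL.idm (A := A) n); rwa [comp_idm] at this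
  · rw [cupAt_of_gt A (by omega)]; exact IsTL.zero

/-- Bookkeeping lemma `capAt` of the binor tensor model of Temperley–Lieb recoupling theory (conventions of KL94 §8.2, §9). [folklore] -/
theorem capAt (n i : ℕ) : IsTL A (Mor.capAt A n i) := by
  by_cases hi : i ≤ n
  · have := IsTL.cap_comp i hi _ (IsTL.idm (A := A) (n + 2)); rwa [comp_idm] at this
  · rw [capAt_of_gt A (by omega)]; exact IsTL.zero

/-- Bookkeeping lemma `cast` of the binor tensor model of Temperley–Lieb recoupling theory (conventions of KL94 §8.2, §9). [folklore] -/
theorem cast {X : Mor K m n} (hX : IsTL A X) (hm : m = m') (hn : n = n') : IsTL A (X.cast hm hn) := by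
  subst hm hn; exact hX

/-- Closure under `- ⊗ 𝟙_k`. [folklore] -/
theorem tens_idm {X : Mor K m n} (hX : IsTL A X) (k : ℕ) : IsTL A (X ⊗ₘ Mor.idm k) := by
  induction hX with
  | idm => rw [idm_tens_idm]; exact IsTL.idm _
  | cup_comp i hi X _ ih =>
    rw [← tens_idm_comp_tens_idm]
    refine IsTL.comp ?_ _ ih
    exact IsTL.of_eq (ext' (by rw [cast_val]; exact (cupAt_add_val A hi k).symm))
      ((IsTL.cupAt (A := A) _ i).cast rfl (by omega))
  | cap_comp i hi X _ ih =>
    rw [← tens_idm_comp_tens_idm]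
    refine IsTL.comp ?_ _ ih
    exact IsTL.of_eq (ext' (by rw [cast_val]; exact (capAt_add_val A hi k).symm))
      ((IsTL.capAt (A := A) _ i).cast (by omega) (by omega))
  | zero => rw [zero_tens]; exact IsTL.zero
  | add X X' _ _ ih ih' => rw [add_tens]; exact IsTL.add _ _ ih ih'
  | smul c X _ ih => rw [smul_tens]; exact IsTL.smul c _ ih

/-- Closure under `𝟙_k ⊗ -`. [folklore] -/
theorem idm_tens (k : ℕ) {X : Mor K m n} (hX : IsTL A X) : IsTL A (Mor.idm k ⊗ₘ X) := by
  induction hX with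
  | idm => rw [idm_tens_idm]; exact IsTL.idm _
  | cup_comp i hi X _ ih =>
    rw [← idm_tens_comp_idm_tens]
    refine IsTL.comp ?_ _ ih
    exact IsTL.of_eq (ext' (by rw [cast_val]; exact (idm_tens_cupAt_val A k hi).symm))
      ((IsTL.cupAt (A := A) (k + _) (k + i)).cast rfl (by omega))
  | cap_comp i hi X _ ih =>
    rw [← idm_tens_comp_idm_tens]
    refine IsTL.comp ?_ _ ih
    exact IsTL.of_eq (ext' (by rw [cast_val]; exact (idm_tens_capAt_val A k hi).symm))
      ((IsTL.capAt (A := A) (k + _) (k + i)).cast (by omega) rfl)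
  | zero => rw [tens_zero]; exact IsTL.zero
  | add X X' _ _ ih ih' => rw [tens_add]; exact IsTL.add _ _ ih ih'
  | smul c X _ ih => rw [tens_smul]; exact IsTL.smul c _ ih

/-- Closure under `⊗`. [folklore] -/
theorem tens {X : Mor K m n} {Y : Mor K m' n'} (hX : IsTL A X) (hY : IsTL A Y) : IsTL A (X ⊗ₘ Y) := by
  rw [tens_eq_comp_left]
  exact (hX.tens_idm _).comp _ (hY.idm_tens _)

/-- Bookkeeping lemma `cup` of the binor tensor model of Temperley–Lieb recoupling theory (conventions of KL94 §8.2, §9). [folklore] -/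
theorem cup : IsTL A (Mor.cup A) := by
  have h := IsTL.cupAt (A := A) 0 0
  rw [cupAt_last] at h
  have e : (Mor.idm 0 ⊗ₘ Mor.cup A :) = (Mor.cup A).cast rfl rfl := ext' (tensR_zero_zero_idR_zero _)
  rw [e] at h
  exact h

/-- Bookkeeping lemma `cap` of the binor tensor model of Temperley–Lieb recoupling theory (conventions of KL94 §8.2, §9). [folklore] -/
theorem cap : IsTL A (Mor.cap A) := by
  have h := IsTL.capAt (A := A) 0 0
  rw [capAt_last] at h
  have e : (Mor.idm 0 ⊗ₘ Mor.cap A :) = (Mor.cap A).cast rfl rfl := ext' (tensR_zero_zero_idR_zero _)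
  rw [e] at h
  exact h

/-- Bookkeeping lemma `U` of the binor tensor model of Temperley–Lieb recoupling theory (conventions of KL94 §8.2, §9). [folklore] -/
theorem U : IsTL A (Mor.U A) := IsTL.cup.comp _ IsTL.cap

/-- Bookkeeping lemma `UAt` of the binor tensor model of Temperley–Lieb recoupling theory (conventions of KL94 §8.2, §9). [folklore] -/
theorem UAt (n i : ℕ) : IsTL A (Mor.UAt A n i) := (IsTL.cupAt n i).comp _ (IsTL.capAt n i)

/-- Bookkeeping lemma `jw` of the binor tensor model of Temperley–Lieb recoupling theory (conventions of KL94 §8.2, §9). [folklore] -/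
theorem jw : ∀ n : ℕ, IsTL A (Mor.jw A n)
  | 0 => by rw [jw_zero]; exact IsTL.idm 0
  | 1 => by rw [jw_one]; exact IsTL.idm 1
  | n + 2 => by
    rw [jw_succ_succ]
    have hP : IsTL A (Mor.jw A (n + 1) ⊗ₘ Mor.idm 1 :) := (IsTL.jw (n + 1)).tens_idm 1
    exact hP.sub ((((hP.comp _ ((IsTL.idm n).tens IsTL.U)).comp _ hP)).smul _ _)

/-- Bookkeeping lemma `trpm` of the binor tensor model of Temperley–Lieb recoupling theory (conventions of KL94 §8.2, §9). [folklore] -/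
theorem trpm {X : Mor K m n} (hX : IsTL A X) : IsTL A (Mor.trpm X) := by
  induction hX with
  | idm => rw [trpm_idm]; exact IsTL.idm _
  | cup_comp i hi X _ ih => rw [trpm_comp, trpm_cupAt, comp_neg]; exact (ih.comp _ (IsTL.capAt _ _)).neg
  | cap_comp i hi X _ ih => rw [trpm_comp, trpm_capAt, comp_neg]; exact (ih.comp _ (IsTL.cupAt _ _)).neg
  | zero => rw [trpm_zero]; exact IsTL.zero
  | add X X' _ _ ih ih' => rw [trpm_add]; exact IsTL.add _ _ ih ih'
  | smul c X _ ih => rw [trpm_smul]; exact IsTL.smul c _ ih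

end IsTL

/-! ### Cup composites and the normal-form argument behind Schur's lemma -/

namespace IsCups

variable {A : K}

/-- Bookkeeping lemma `isTL` of the binor tensor model of Temperley–Lieb recoupling theory (conventions of KL94 §8.2, §9). [folklore] -/
theorem isTL {C : Mor K m n} (h : IsCups A C) : IsTL A C := by
  induction h with
  | idm => exact IsTL.idm _
  | cup_comp i hi C _ ih => exact IsTL.cup_comp i hi C ih

/-- Bookkeeping lemma `le` of the binor tensor model of Temperley–Lieb recoupling theory (conventions of KL94 §8.2, §9). [folklore] -/
theorem le {C : Mor K m n} (h : IsCups A C) : m ≤ n := by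
  induction h with
  | idm => exact le_rfl
  | cup_comp i hi C _ ih => omega

/-- Bookkeeping lemma `eq_idm` of the binor tensor model of Temperley–Lieb recoupling theory (conventions of KL94 §8.2, §9). [folklore] -/
theorem eq_idm {N : ℕ} {C : Mor K m N} (h : IsCups A C) (e : N = m) : C.cast rfl e = Mor.idm m := by
  cases h with
  | idm => rfl
  | cup_comp i hi C hC => have := hC.le; omega

end IsCups


variable {A : K}

/-- Bookkeeping lemma `comp_jw_mem_cupSpan_of_isCups` of the binor tensor model of Temperley–Lieb recoupling theory (conventions of KL94 §8.2, §9). [folklore] -/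
theorem comp_jw_mem_cupSpan_of_isCups {C : Mor K m n} (h : IsCups A C) : C ⊚ jw A m ∈ cupSpan A m n :=
  Submodule.subset_span ⟨C, h, rfl⟩

/-- Bookkeeping lemma `cupAt_comp_mem_cupSpan` of the binor tensor model of Temperley–Lieb recoupling theory (conventions of KL94 §8.2, §9). [folklore] -/
theorem cupAt_comp_mem_cupSpan {i n : ℕ} (hi : i ≤ n) {Y : Mor K m n} (hY : Y ∈ cupSpan A m n) :
    cupAt A n i ⊚ Y ∈ cupSpan A m (n + 2) := by
  have key : cupSpan A m n ≤ (cupSpan A m (n + 2)).comap (compLeftL (cupAt A n i)) := by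
    rw [cupSpan, Submodule.span_le]
    rintro _ ⟨C, hC, rfl⟩
    simp only [Submodule.comap_coe, Set.mem_preimage, compLeftL_apply, SetLike.mem_coe, comp_assoc]
    exact comp_jw_mem_cupSpan_of_isCups (hC.cup_comp i hi)
  exact key hY

/-- Pushing a cap through a composite of cups: the result is again in the cup span (zig-zags,
free loops, far commutation, and caps landing on `f_m` vanish). [cite: KauffmanLins1994, §7.1 Lemma 17] -/
theorem capAt_cups_jw_mem (hA : A ≠ 0) (hg : Good A m) {N : ℕ} {C : Mor K m N} (hC : IsCups A C) :
    ∀ (n i : ℕ) (e : N = n + 2), i ≤ n → (capAt A n i ⊚ C.cast rfl e) ⊚ jw A m ∈ cupSpan A m n := by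
  induction hC with
  | idm =>
    intro n i e hi
    subst e
    rw [cast_eq_self, comp_idm, capAt_comp_jw hA hg hi]
    exact Submodule.zero_mem _
  | @cup_comp N' i' hi' C' hC' ih =>
    intro n i e hi
    obtain rfl : N' = n := by omega
    rw [cast_eq_self]
    rcases Nat.lt_or_ge i' i with h1 | h1
    · rcases Nat.lt_or_ge (i' + 1) i with h2 | h2
      · -- far: i' + 2 ≤ i
        obtain ⟨n'', rfl⟩ : ∃ n'', N' = n'' + 2 := ⟨N' - 2, by omega⟩
        rw [comp_assoc, capAt_cupAt_far' A (by omega) hi, ← comp_assoc (cupAt A n'' i') (capAt A n'' _) C',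
          ← comp_assoc (cupAt A n'' i') _ (jw A m)]
        exact cupAt_comp_mem_cupSpan (by omega) (by simpa [cast_eq_self] using ih n'' (i - 2) rfl (by omega))
      · -- i = i' + 1
        obtain rfl : i = i' + 1 := by omega
        rw [comp_assoc, capAt_succ_cupAt A hA hi, idm_comp]
        exact comp_jw_mem_cupSpan_of_isCups hC'
    · rcases Nat.lt_or_ge i i' with h2 | h2
      · rcases Nat.lt_or_ge (i + 1) i' with h3 | h3
        · -- far: i + 2 ≤ i'
          obtain ⟨n'', rfl⟩ : ∃ n'', N' = n'' + 2 := ⟨N' - 2, by omega⟩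
          rw [comp_assoc, capAt_cupAt_far A (by omega) hi', ← comp_assoc (cupAt A n'' _) (capAt A n'' i) C',
            ← comp_assoc (cupAt A n'' _) _ (jw A m)]
          exact cupAt_comp_mem_cupSpan (by omega) (by simpa [cast_eq_self] using ih n'' i rfl (by omega))
        · -- i' = i + 1
          obtain rfl : i' = i + 1 := by omega
          rw [comp_assoc, capAt_cupAt_succ A hA hi', idm_comp]
          exact comp_jw_mem_cupSpan_of_isCups hC'
      · -- i = i'
        obtain rfl : i = i' := by omega
        rw [comp_assoc, capAt_cupAt_same A hi, smul_comp, idm_comp, smul_comp]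
        exact Submodule.smul_mem _ _ (comp_jw_mem_cupSpan_of_isCups hC')

/-- The normal-form theorem in span form: for a Temperley–Lieb morphism `X : m → n`,
`X ∘ f_m` lies in the span of `C ∘ f_m`, `C` a composite of cups. [cite: KauffmanLins1994, §7.1 (proof of Lemma 17)] -/
theorem comp_jw_mem_cupSpan (hA : A ≠ 0) {X : Mor K m n} (hX : IsTL A X) (hg : Good A m) :
    X ⊚ jw A m ∈ cupSpan A m n := by
  induction hX with
  | idm => exact comp_jw_mem_cupSpan_of_isCups (IsCups.idm _)
  | cup_comp i hi X _ ih => rw [← comp_assoc]; exact cupAt_comp_mem_cupSpan hi ih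
  | @cap_comp n' i hi X _ ih =>
    rw [← comp_assoc]
    have key : cupSpan A m (n' + 2) ≤ (cupSpan A m n').comap (compLeftL (capAt A n' i)) := by
      rw [cupSpan, Submodule.span_le]
      rintro _ ⟨C, hC, rfl⟩
      simp only [Submodule.comap_coe, Set.mem_preimage, compLeftL_apply, SetLike.mem_coe, comp_assoc]
      simpa [cast_eq_self] using capAt_cups_jw_mem hA hg hC n' i rfl hi
    exact key ih
  | zero => rw [zero_comp]; exact Submodule.zero_mem _
  | add X X' _ _ ih ih' => rw [add_comp]; exact Submodule.add_mem _ ih ih'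
  | smul c X _ ih => rw [smul_comp]; exact Submodule.smul_mem _ c ih

/-- **Schur's lemma for the Jones–Wenzl projector**: every Temperley–Lieb endomorphism of `n`
strands acts on `f_n` by a scalar, `X f_n = c f_n`. [cite: KauffmanLins1994, §3.2 (𝒰_n), §5.1 Lemma 5–6] -/
theorem comp_jw_eq_smul (hA : A ≠ 0) {X : Mor K n n} (hX : IsTL A X) (hg : Good A n) :
    ∃ c : K, X ⊚ jw A n = c • jw A n := by
  have h := comp_jw_mem_cupSpan hA hX hg
  have hS : {Y : Mor K n n | ∃ C : Mor K n n, IsCups A C ∧ Y = C ⊚ jw A n} = {jw A n} := by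
    ext Y
    simp only [Set.mem_setOf_eq, Set.mem_singleton_iff]
    constructor
    · rintro ⟨C, hC, rfl⟩
      rw [show C = idm n from by simpa [cast_eq_self] using hC.eq_idm rfl, idm_comp]
    · rintro rfl; exact ⟨idm n, IsCups.idm n, (idm_comp _).symm⟩
  rw [cupSpan, hS, Submodule.mem_span_singleton] at h
  obtain ⟨c, hc⟩ := h
  exact ⟨c, hc.symm⟩

/-- Temperley–Lieb morphisms between projectors of different sizes vanish: `f_n X f_m = 0`
for `m ≠ n`. [cite: KauffmanLins1994, §5.1 Lemma 7 (first part)] -/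
theorem jw_comp_comp_jw_eq_zero (hA : A ≠ 0) {X : Mor K m n} (hX : IsTL A X) (hmn : m ≠ n)
    (hgm : Good A m) (hgn : Good A n) : jw A n ⊚ X ⊚ jw A m = 0 := by
  have h := comp_jw_mem_cupSpan hA hX hgm
  have key : cupSpan A m n ≤ LinearMap.ker (compLeftL (jw A n)) := by
    rw [cupSpan, Submodule.span_le]
    rintro _ ⟨C, hC, rfl⟩
    simp only [SetLike.mem_coe, LinearMap.mem_ker, compLeftL_apply]
    cases hC with
    | idm => exact absurd rfl hmn
    | cup_comp i hi C' hC' =>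
      rw [comp_assoc, comp_assoc, jw_comp_cupAt hA hgn hi, zero_comp, zero_comp]
  have := key h
  rw [LinearMap.mem_ker, compLeftL_apply, comp_assoc] at this
  exact this

/-! ### Weights, the trace as a weighted sum, cyclicity -/


/-- Bookkeeping lemma `ct_zero` of the binor tensor model of Temperley–Lieb recoupling theory (conventions of KL94 §8.2, §9). [folklore] -/
theorem ct_zero (s : Idx) : ct 0 s = 0 := by simp [ct]

/-- Bookkeeping lemma `ct_succ` of the binor tensor model of Temperley–Lieb recoupling theory (conventions of KL94 §8.2, §9). [folklore] -/
theorem ct_succ (n : ℕ) (s : Idx) : ct (n + 1) s = ct n s + (if s n = true then 1 else 0) := by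
  unfold ct
  rw [Finset.range_add_one, Finset.filter_insert]
  by_cases h : s n = true
  · rw [if_pos h, if_pos h, Finset.card_insert_of_notMem (by simp)]
  · rw [if_neg h, if_neg h, Nat.add_zero]

/-- Bookkeeping lemma `ct_le` of the binor tensor model of Temperley–Lieb recoupling theory (conventions of KL94 §8.2, §9). [folklore] -/
theorem ct_le (n : ℕ) (s : Idx) : ct n s ≤ n := by
  unfold ct
  exact (Finset.card_filter_le _ _).trans (by simp)

/-- Bookkeeping lemma `ct_congr` of the binor tensor model of Temperley–Lieb recoupling theory (conventions of KL94 §8.2, §9). [folklore] -/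
theorem ct_congr {n : ℕ} {s t : Idx} (h : Agree n s t) : ct n s = ct n t := by
  unfold ct
  congr 1
  exact Finset.filter_congr (fun i hi => by rw [h i (Finset.mem_range.mp hi)])

/-- Bookkeeping lemma `ct_add` of the binor tensor model of Temperley–Lieb recoupling theory (conventions of KL94 §8.2, §9). [folklore] -/
theorem ct_add (n n' : ℕ) (s : Idx) : ct (n + n') s = ct n s + ct n' (shift n s) := by
  induction n' with
  | zero => rw [Nat.add_zero, ct_zero, Nat.add_zero]
  | succ n' ih => rw [Nat.add_succ, ct_succ, ih, ct_succ, shift_apply, Nat.add_assoc]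

/-- Bookkeeping lemma `ct_two` of the binor tensor model of Temperley–Lieb recoupling theory (conventions of KL94 §8.2, §9). [folklore] -/
theorem ct_two (t : Idx) : ct 2 t = (if t 0 = true then 1 else 0) + (if t 1 = true then 1 else 0) := by
  rw [show (2 : ℕ) = 0 + 1 + 1 from rfl, ct_succ, ct_succ, ct_zero, Nat.zero_add]


/-- Bookkeeping lemma `idR` of the binor tensor model of Temperley–Lieb recoupling theory (conventions of KL94 §8.2, §9). [folklore] -/
theorem WtPres.idR (n : ℕ) : WtPres n n (idR (K := K) n) := by
  intro s t h
  rw [idR_apply] at h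
  by_cases ha : Agree n s t
  · rw [ct_congr ha]
  · rw [if_neg ha] at h; exact absurd rfl h

/-- Bookkeeping lemma `capR` of the binor tensor model of Temperley–Lieb recoupling theory (conventions of KL94 §8.2, §9). [folklore] -/
theorem WtPres.capR (A : K) : WtPres 2 0 (capR A) := by
  intro s t h
  rw [capR_apply] at h
  rw [ct_zero, ct_two]
  revert h
  cases t 0 <;> cases t 1 <;> simp

/-- Bookkeeping lemma `cupR` of the binor tensor model of Temperley–Lieb recoupling theory (conventions of KL94 §8.2, §9). [folklore] -/
theorem WtPres.cupR (A : K) : WtPres 0 2 (cupR A) := by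
  intro s t h
  rw [cupR_apply] at h
  rw [ct_zero, ct_two]
  revert h
  cases s 0 <;> cases s 1 <;> simp

/-- Bookkeeping lemma `compR` of the binor tensor model of Temperley–Lieb recoupling theory (conventions of KL94 §8.2, §9). [folklore] -/
theorem WtPres.compR {X Y : Raw K} (hX : WtPres n p X) (hY : WtPres m n Y) : WtPres m p (compR n X Y) := by
  intro s t h
  rw [compR_apply] at h
  obtain ⟨u, _, hu⟩ := Finset.exists_ne_zero_of_sum_ne_zero h
  have h1 := hX s (pad u) (left_ne_zero_of_mul hu)
  have h2 := hY (pad u) t (right_ne_zero_of_mul hu)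
  omega

/-- Bookkeeping lemma `tensR` of the binor tensor model of Temperley–Lieb recoupling theory (conventions of KL94 §8.2, §9). [folklore] -/
theorem WtPres.tensR {X Y : Raw K} (hX : WtPres m n X) (hY : WtPres m' n' Y) :
    WtPres (m + m') (n + n') (tensR n m X Y) := by
  intro s t h
  rw [tensR_apply] at h
  have h1 := hX s t (left_ne_zero_of_mul h)
  have h2 := hY _ _ (right_ne_zero_of_mul h)
  rw [ct_add, ct_add]
  omega

/-- Bookkeeping lemma `add` of the binor tensor model of Temperley–Lieb recoupling theory (conventions of KL94 §8.2, §9). [folklore] -/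
theorem WtPres.add {X Y : Raw K} (hX : WtPres m n X) (hY : WtPres m n Y) : WtPres m n (X + Y) := by
  intro s t h
  simp only [Pi.add_apply] at h
  by_cases h1 : X s t = 0
  · rw [h1, zero_add] at h; exact hY s t h
  · exact hX s t h1

/-- Bookkeeping lemma `smul` of the binor tensor model of Temperley–Lieb recoupling theory (conventions of KL94 §8.2, §9). [folklore] -/
theorem WtPres.smul (c : K) {X : Raw K} (hX : WtPres m n X) : WtPres m n (c • X) := by
  intro s t h
  simp only [Pi.smul_apply, smul_eq_mul] at h
  exact hX s t (right_ne_zero_of_mul h)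

/-- Bookkeeping lemma `zero` of the binor tensor model of Temperley–Lieb recoupling theory (conventions of KL94 §8.2, §9). [folklore] -/
theorem WtPres.zero : WtPres m n (0 : Raw K) := fun _ _ h => absurd rfl h

/-- Temperley–Lieb morphisms preserve the weight. [folklore] -/
theorem IsTL.wtPres {A : K} {X : Mor K m n} (hX : IsTL A X) : WtPres m n X.val := by
  induction hX with
  | idm => exact WtPres.idR _
  | @cup_comp n i hi X _ ih =>
    have h1 : WtPres n (n + 2) (Mor.cupAt A n i).val := by
      rw [cupAt_val A hi]
      unfold block
      have := ((WtPres.idR (K := K) i).tensR (WtPres.cupR A)).tensR (WtPres.idR (K := K) (n - i))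
      rwa [show i + 0 + (n - i) = n by omega, show i + 2 + (n - i) = n + 2 by omega] at this
    rw [comp_val]
    exact h1.compR ih
  | @cap_comp n i hi X _ ih =>
    have h1 : WtPres (n + 2) n (Mor.capAt A n i).val := by
      rw [capAt_val A hi]
      unfold block
      have := ((WtPres.idR (K := K) i).tensR (WtPres.capR A)).tensR (WtPres.idR (K := K) (n - i))
      rwa [show i + 0 + (n - i) = n by omega, show i + 2 + (n - i) = n + 2 by omega] at this
    rw [comp_val]
    exact h1.compR ih
  | zero => exact WtPres.zero
  | add X X' _ _ ih ih' => exact ih.add ih'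
  | smul c X _ ih => exact ih.smul c


/-- Bookkeeping lemma `bw_false_eq` of the binor tensor model of Temperley–Lieb recoupling theory (conventions of KL94 §8.2, §9). [folklore] -/
theorem bw_false_eq (A : K) : bw A false = (-A ^ 2)⁻¹ := by
  rw [bw_false, inv_neg, inv_pow]


/-- Bookkeeping lemma `wprod_zero` of the binor tensor model of Temperley–Lieb recoupling theory (conventions of KL94 §8.2, §9). [folklore] -/
theorem wprod_zero (A : K) (s : Idx) : wprod A 0 s = 1 := by simp [wprod]

/-- Bookkeeping lemma `wprod_succ` of the binor tensor model of Temperley–Lieb recoupling theory (conventions of KL94 §8.2, §9). [folklore] -/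
theorem wprod_succ (A : K) (n : ℕ) (s : Idx) : wprod A (n + 1) s = wprod A n s * bw A (s n) := by
  simp [wprod, Finset.prod_range_succ]

/-- Bookkeeping lemma `wprod_congr` of the binor tensor model of Temperley–Lieb recoupling theory (conventions of KL94 §8.2, §9). [folklore] -/
theorem wprod_congr (A : K) {n : ℕ} {s t : Idx} (h : Agree n s t) : wprod A n s = wprod A n t :=
  Finset.prod_congr rfl (fun i hi => by rw [h i (Finset.mem_range.mp hi)])

/-- Bookkeeping lemma `wprod_eq` of the binor tensor model of Temperley–Lieb recoupling theory (conventions of KL94 §8.2, §9). [folklore] -/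
theorem wprod_eq (A : K) (n : ℕ) (s : Idx) :
    wprod A n s = (-A ^ 2) ^ (ct n s) * ((-A ^ 2)⁻¹) ^ (n - ct n s) := by
  induction n with
  | zero => rw [wprod_zero, ct_zero]; simp
  | succ n ih =>
    rw [wprod_succ, ih, ct_succ]
    have hle := ct_le n s
    cases hs : s n
    · simp only [Bool.false_eq_true, if_false, Nat.add_zero]
      rw [bw_false_eq, show n + 1 - ct n s = (n - ct n s) + 1 by omega, pow_succ]
      ring
    · simp only [if_true, bw_true]
      rw [show n + 1 - (ct n s + 1) = n - ct n s by omega, pow_succ]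
      ring


/-- Bookkeeping lemma `pad_append_one` of the binor tensor model of Temperley–Lieb recoupling theory (conventions of KL94 §8.2, §9). [folklore] -/
theorem pad_append_one (s : Fin n → Bool) (a : Bool) (i : ℕ) :
    pad (Fin.append s (fun _ : Fin 1 => a)) i = if i < n then pad s i else if i = n then a else false := by
  by_cases h : i < n
  · rw [if_pos h, pad_apply_lt _ (by omega), pad_apply_lt _ h]
    exact Fin.append_left s _ ⟨i, h⟩
  · rw [if_neg h]
    by_cases h' : i = n
    · subst h'
      rw [if_pos rfl, pad_apply_lt _ (by omega)]
      exact Fin.append_right s (fun _ : Fin 1 => a) ⟨0, Nat.zero_lt_one⟩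
    · rw [if_neg h', pad_apply_ge _ (by omega)]

/-- Bookkeeping lemma `agree_pad_append_one` of the binor tensor model of Temperley–Lieb recoupling theory (conventions of KL94 §8.2, §9). [folklore] -/
theorem agree_pad_append_one (s : Fin n → Bool) (a : Bool) : Agree n (pad (Fin.append s (fun _ : Fin 1 => a))) (pad s) :=
  fun i hi => by rw [pad_append_one, if_pos hi]

/-- Bookkeeping lemma `pad_append_one_last` of the binor tensor model of Temperley–Lieb recoupling theory (conventions of KL94 §8.2, §9). [folklore] -/
theorem pad_append_one_last (s : Fin n → Bool) (a : Bool) : pad (Fin.append s (fun _ : Fin 1 => a)) n = a := by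
  rw [pad_append_one, if_neg (lt_irrefl n), if_pos rfl]

/-- Bookkeeping lemma `agree_pad_pad_append_iff` of the binor tensor model of Temperley–Lieb recoupling theory (conventions of KL94 §8.2, §9). [folklore] -/
theorem agree_pad_pad_append_iff (s s' : Fin n → Bool) (w : Fin m → Bool) :
    Agree n (pad s) (pad (Fin.append s' w)) ↔ s' = s := by
  constructor
  · intro h
    have h2 : Agree n (pad s) (pad s') := h.trans (agree_pad_append s' w)
    rw [agree_pad_iff, take_pad] at h2
    exact h2.symm
  · rintro rfl; exact (agree_pad_append s' w).symm

/-- Bookkeeping lemma `agree_pad_append_pad_iff` of the binor tensor model of Temperley–Lieb recoupling theory (conventions of KL94 §8.2, §9). [folklore] -/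
theorem agree_pad_append_pad_iff (v t : Fin n → Bool) (w : Fin m → Bool) :
    Agree n (pad (Fin.append v w)) (pad t) ↔ v = t := by
  rw [show Agree n (pad (Fin.append v w)) (pad t) ↔ Agree n (pad t) (pad (Fin.append v w)) from
    ⟨Agree.symm, Agree.symm⟩, agree_pad_pad_append_iff]

/-- Bookkeeping lemma `pad_append_add` of the binor tensor model of Temperley–Lieb recoupling theory (conventions of KL94 §8.2, §9). [folklore] -/
theorem pad_append_add (u : Fin n → Bool) (w : Fin m → Bool) (j : ℕ) :
    pad (Fin.append u w) (n + j) = pad w j := by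
  have := congrFun (shift_pad_append u w) j
  rwa [shift_apply] at this

/-- Bookkeeping lemma `pad_one` of the binor tensor model of Temperley–Lieb recoupling theory (conventions of KL94 §8.2, §9). [folklore] -/
theorem pad_one (a : Bool) : pad (fun _ : Fin 1 => a) 0 = a := by
  rw [pad_apply_lt _ Nat.zero_lt_one]

/-- Bookkeeping lemma `pad_append_last` of the binor tensor model of Temperley–Lieb recoupling theory (conventions of KL94 §8.2, §9). [folklore] -/
theorem pad_append_last (u : Fin n → Bool) (w : Fin m → Bool) : pad (Fin.append u w) n = pad w 0 := by
  rw [← pad_append_add u w 0, Nat.add_zero]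

/-- Bookkeeping lemma `pad_append_lt` of the binor tensor model of Temperley–Lieb recoupling theory (conventions of KL94 §8.2, §9). [folklore] -/
theorem pad_append_lt (u : Fin n → Bool) (w : Fin m → Bool) {i : ℕ} (hi : i < n) :
    pad (Fin.append u w) i = pad u i :=
  agree_pad_append u w i hi

/-- Bookkeeping lemma `agree_pad_append_append_pad_iff` of the binor tensor model of Temperley–Lieb recoupling theory (conventions of KL94 §8.2, §9). [folklore] -/
theorem agree_pad_append_append_pad_iff (u t : Fin n → Bool) (v : Fin m → Bool) (w : Fin m' → Bool) :
    Agree n (pad (Fin.append (Fin.append u v) w)) (pad t) ↔ u = t := by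
  have h1 : Agree n (pad (Fin.append (Fin.append u v) w)) (pad u) :=
    ((agree_pad_append (Fin.append u v) w).mono (Nat.le_add_right n m)).trans (agree_pad_append u v)
  constructor
  · intro h
    have := h1.symm.trans h
    rw [agree_pad_iff, take_pad] at this
    exact this
  · rintro rfl; exact h1

/-- Bookkeeping lemma `agree_pad_append_pad_append_one` of the binor tensor model of Temperley–Lieb recoupling theory (conventions of KL94 §8.2, §9). [folklore] -/
theorem agree_pad_append_pad_append_one (s : Fin n → Bool) (w : Fin m → Bool) :
    Agree (n + 1) (pad (Fin.append s w)) (pad (Fin.append s fun _ : Fin 1 => pad w 0)) := by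
  intro i hi
  by_cases h : i < n
  · rw [pad_append_lt _ _ h, pad_append_lt _ _ h]
  · obtain rfl : i = n := by omega
    rw [pad_append_last, pad_append_last, pad_one]

/-- Bookkeeping lemma `cons_elim0_eq` of the binor tensor model of Temperley–Lieb recoupling theory (conventions of KL94 §8.2, §9). [folklore] -/
theorem cons_elim0_eq (b : Bool) : (Fin.cons b (fun i : Fin 0 => i.elim0) : Fin 1 → Bool) = fun _ => b := by
  funext i
  rw [Fin.eq_zero i]
  rfl

/-- Bookkeeping lemma `pad_append_append_one` of the binor tensor model of Temperley–Lieb recoupling theory (conventions of KL94 §8.2, §9). [folklore] -/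
theorem pad_append_append_one (t : Fin n → Bool) (x : Fin 1 → Bool) (w : Fin m → Bool) :
    pad (Fin.append (Fin.append t x) w) n = pad x 0 := by
  rw [pad_append_lt _ _ (Nat.lt_succ_self n), pad_append_last]

namespace Mor

variable (A : K)

/-- Entries of the partial trace: `(rptr X)_{s,t} = Σ_a bw(a) X_{(s,a),(t,a)}`. [cite: KauffmanLins1994, §9.8] -/
theorem rptr_pad_pad (X : Mor K (n + 1) (n + 1)) (s t : Fin n → Bool) :
    (rptr A X).val (pad s) (pad t) = ∑ a : Bool, bw A a *
      X.val (pad (Fin.append s fun _ : Fin 1 => a)) (pad (Fin.append t fun _ : Fin 1 => a)) := by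
  simp only [rptr_def, comp_val, tens_val, idm_val, cap_val, cup_val]
  simp only [compR_apply, tensR_apply, idR_apply, capR_apply, cupR_apply, shift_apply, sum_split,
    agree_pad_pad_append_iff, agree_one_iff, Nat.add_zero, pad_append_add, pad_append_last,
    agree_pad_append_append_pad_iff]
  -- collapse the Kronecker sum over the first `n` row bits
  simp only [ite_mul, one_mul, zero_mul]
  simp only [Finset.sum_ite_irrel, Finset.sum_const_zero, Finset.sum_ite_eq', Finset.mem_univ, if_true]
  -- reduce the entries of `X` to `(n+1)`-prefixes
  have hX : ∀ (w : Fin 2 → Bool) (u : Fin n → Bool) (v v₁ : Fin 1 → Bool),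
      X.val (pad (Fin.append s w)) (pad (Fin.append (Fin.append u v) v₁)) =
        X.val (pad (Fin.append s fun _ : Fin 1 => pad w 0)) (pad (Fin.append u v)) := fun w u v v₁ => by
    rw [X.respR _ (agree_pad_append_pad_append_one s w), X.respC _ (agree_pad_append (Fin.append u v) v₁)]
  simp only [hX, pad_append_append_one]
  -- collapse the Kronecker sum over the first `n` column bits
  simp only [mul_ite, mul_zero]
  simp only [Finset.sum_ite_irrel, Finset.sum_const_zero, Finset.sum_ite_eq', Finset.mem_univ, if_true]
  -- expand the remaining small sums
  simp only [sum_fin_succ, sum_fin_zero, cons_elim0_eq, pad_cons_zero, pad_cons_succ, Fintype.sum_bool]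
  simp
  ring

/-- The iterated partial trace is the weighted sum of diagonal entries. [cite: KauffmanLins1994, §9.8] -/
theorem trAll_eq_trW : ∀ {n : ℕ} (X : Mor K n n), trAll A X = trW A n X.val
  | 0, X => by
    rw [trAll_zero, trW, sum_fin_zero, pad_fin_zero, wprod_zero, one_mul]
  | n + 1, X => by
    rw [trAll_succ, trAll_eq_trW (rptr A X), trW, trW, sum_split]
    refine Finset.sum_congr rfl (fun s _ => ?_)
    rw [rptr_pad_pad, sum_fin_succ, sum_fin_zero, cons_elim0_eq, cons_elim0_eq, Fintype.sum_bool,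
      wprod_succ, wprod_succ, wprod_congr A (agree_pad_append s _), wprod_congr A (agree_pad_append s _),
      pad_append_last, pad_append_last, pad_one, pad_one]
    ring

end Mor

/-- Cyclicity of the weighted trace for a weight-preserving factor. [folklore] -/
theorem trW_compR_comm (A : K) (hA : A ≠ 0) {X Y : Raw K} (hX : WtPres m n X) :
    trW A n (compR m X Y) = trW A m (compR n Y X) := by
  simp only [trW, compR_apply, Finset.mul_sum]
  rw [Finset.sum_comm]
  refine Finset.sum_congr rfl (fun u _ => Finset.sum_congr rfl (fun s _ => ?_))
  by_cases h : X (pad s) (pad u) = 0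
  · rw [h, mul_zero, zero_mul, mul_zero, mul_zero]
  · have hw := hX _ _ h
    have ha := ct_le n (pad s)
    have hb := ct_le m (pad u)
    have hx : (-A ^ 2 : K) ≠ 0 := neg_ne_zero.mpr (pow_ne_zero 2 hA)
    have key : wprod A n (pad s) = wprod A m (pad u) := by
      rw [wprod_eq, wprod_eq, inv_pow, inv_pow, ← div_eq_mul_inv, ← div_eq_mul_inv,
        div_eq_div_iff (pow_ne_zero _ hx) (pow_ne_zero _ hx), ← pow_add, ← pow_add]
      congr 1
      omega
    rw [key]
    ring

namespace Mor

/-- **Cyclicity of the trace** `tr(XY) = tr(YX)` for Temperley–Lieb `X`. [cite: KauffmanLins1994, §2.2 (tr(ab) = tr(ba))] -/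
theorem trAll_comp_comm (hA : A ≠ 0) {X : Mor K n m} (hX : IsTL A X) (Y : Mor K m n) :
    trAll A (X ⊚ Y) = trAll A (Y ⊚ X) := by
  rw [trAll_eq_trW, trAll_eq_trW, comp_val, comp_val]
  exact trW_compR_comm A hA hX.wtPres

/-! ### The highest-weight column of `f_n` and left absorption -/

end Mor


/-- Bookkeeping lemma `shift_allT` of the binor tensor model of Temperley–Lieb recoupling theory (conventions of KL94 §8.2, §9). [folklore] -/
@[simp] theorem shift_allT (n : ℕ) : shift n allT = allT := rfl

/-- Bookkeeping lemma `sum_mul_ite_agree_pad_allT` of the binor tensor model of Temperley–Lieb recoupling theory (conventions of KL94 §8.2, §9). [folklore] -/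
theorem sum_mul_ite_agree_pad_allT {M : Type*} [NonAssocSemiring M] (F : (Fin n → Bool) → M) :
    ∑ u : Fin n → Bool, F u * (if Agree n (pad u) allT then 1 else 0) = F (take n allT) := by
  have : ∀ u : Fin n → Bool, (F u * if Agree n (pad u) allT then 1 else 0) =
      if Agree n allT (pad u) then F u else 0 := fun u => by
    by_cases h : Agree n (pad u) allT
    · rw [if_pos h, if_pos h.symm, mul_one]
    · rw [if_neg h, if_neg (fun h' => h h'.symm), mul_zero]
  simp only [this]
  exact sum_ite_agree_pad allT F

namespace Mor

variable {A : K}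

/-- The hook kills the highest weight vector: `U_{•,(+,+)} = 0`. [folklore] -/
theorem U_val_allT (s t : Idx) (ht : Agree 2 t allT) : (U A).val s t = 0 := by
  rw [agree_two_iff] at ht
  simp only [U, comp_val, cup_val, cap_val, compR_apply, sum_fin_zero, capR_apply, ht.1, ht.2,
    allT_apply, capv_tt, mul_zero]

/-- The highest-weight column of the Jones–Wenzl projector: `f_n e_{+⋯+} = e_{+⋯+}`.
[cite: KauffmanLins1994, §3.2 (f = 1 + 𝒰)] -/
theorem jw_val_allT : ∀ (n : ℕ) (s : Idx), (jw A n).val s allT = if Agree n s allT then 1 else 0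
  | 0, s => by rw [jw_zero, idm_val, idR_apply]
  | 1, s => by rw [jw_one, idm_val, idR_apply]
  | n + 2, s => by
    have hP : ∀ s' : Idx, (jw A (n + 1) ⊗ₘ idm 1 :).val s' allT = if Agree (n + 2) s' allT then 1 else 0 := by
      intro s'
      rw [tens_val, tensR_apply, jw_val_allT (n + 1), idm_val, idR_apply, shift_allT]
      simp only [agree_add_iff (n := n + 1) (n' := 1) s' allT, shift_allT]
      by_cases h1 : Agree (n + 1) s' allT <;> by_cases h2 : Agree 1 (shift (n + 1) s') allT <;> simp [h1, h2]
    rw [jw_succ_succ]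
    simp only [sub_val, smul_val, Pi.sub_apply, Pi.smul_apply, comp_val, compR_apply, hP,
      sum_mul_ite_agree_pad_allT]
    have hB : ∀ u : Fin (n + 2) → Bool, (idm n ⊗ₘ U A :).val (pad u) (pad (take (n + 2) allT)) = 0 := by
      intro u
      rw [tens_val, tensR_apply, idm_val, U_val_allT, mul_zero]
      intro i hi
      rw [shift_apply, pad_apply_lt _ (by omega), allT_apply]
      rfl
    simp [hB]

/-- The highest-weight column of `f_k ⊗ -`-type morphisms: general form used for absorption. [folklore] -/
theorem idm_tens_jw_val_allT (k n : ℕ) (s : Idx) :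
    (idm k ⊗ₘ jw A n :).val s allT = if Agree (k + n) s allT then 1 else 0 := by
  rw [tens_val, tensR_apply, idm_val, idR_apply, shift_allT, jw_val_allT]
  simp only [agree_add_iff (n := k) (n' := n) s allT, shift_allT]
  by_cases h1 : Agree k s allT <;> by_cases h2 : Agree n (shift k s) allT <;> simp [h1, h2]

/-- Left Schur: `f_n X = c f_n` for Temperley–Lieb `X`. [cite: KauffmanLins1994, §3.2] -/
theorem jw_comp_eq_smul (hA : A ≠ 0) {X : Mor K n n} (hX : IsTL A X) (hg : Good A n) :
    ∃ c : K, jw A n ⊚ X = c • jw A n := by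
  obtain ⟨c, hc⟩ := comp_jw_eq_smul hA hX.trpm hg
  refine ⟨c, ?_⟩
  have := congrArg trpm hc
  rwa [trpm_comp, trpm_trpm, trpm_jw, trpm_smul, trpm_jw] at this

/-- **Left absorption** `f_{k+n} (𝟙_k ⊗ f_n) = f_{k+n}`. [cite: KauffmanLins1994, §3.1] -/
theorem jw_comp_idm_tens_jw (hA : A ≠ 0) (k n : ℕ) (hg : Good A (k + n)) :
    jw A (k + n) ⊚ (idm k ⊗ₘ jw A n) = jw A (k + n) := by
  obtain ⟨c, hc⟩ := jw_comp_eq_smul hA ((IsTL.jw n).idm_tens k) hg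
  have h1 : (jw A (k + n) ⊚ (idm k ⊗ₘ jw A n)).val allT allT = 1 := by
    rw [comp_val, compR_apply]
    simp only [idm_tens_jw_val_allT, sum_mul_ite_agree_pad_allT]
    rw [(jw A (k + n)).respC _ (agree_pad_take _ _), jw_val_allT, if_pos (Agree.refl _ _)]
  have h2 : (c • jw A (k + n)).val allT allT = c := by
    rw [smul_val, Pi.smul_apply, Pi.smul_apply, jw_val_allT, if_pos (Agree.refl _ _), smul_eq_mul, mul_one]
  rw [hc] at h1
  rw [h1] at h2
  rw [hc, ← h2, one_smul]

/-- **Left absorption**, the other order: `(𝟙_k ⊗ f_n) f_{k+n} = f_{k+n}`. [folklore] -/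
theorem idm_tens_jw_comp_jw (hA : A ≠ 0) (k n : ℕ) (hg : Good A (k + n)) :
    (idm k ⊗ₘ jw A n) ⊚ jw A (k + n) = jw A (k + n) := by
  have := congrArg trpm (jw_comp_idm_tens_jw hA k n hg)
  rwa [trpm_comp, trpm_tens, trpm_idm, trpm_jw, trpm_jw] at this

/-! ### The left partial trace and sphericality of the Temperley–Lieb trace -/

variable (A : K)


/-- Bookkeeping lemma `lptr_val` of the binor tensor model of Temperley–Lieb recoupling theory (conventions of KL94 §8.2, §9). [folklore] -/
theorem lptr_val (X : Mor K (m + 1) (n + 1)) : (lptr A X).val =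
    compR (2 + m) (compR (2 + n) (tensR 0 2 (capR A) (idR n)) (tensR 1 1 (idR 1) X.val))
      (tensR 2 0 (cupR A) (idR m)) := rfl

/-- Bookkeeping lemma `rptr_val` of the binor tensor model of Temperley–Lieb recoupling theory (conventions of KL94 §8.2, §9). [folklore] -/
theorem rptr_val (X : Mor K (m + 1) (n + 1)) : (rptr A X).val =
    compR (m + 1 + 1) (compR (n + 2) (tensR n n (idR n) (capR A)) (tensR (n + 1) (m + 1) X.val (idR 1)))
      (tensR m m (idR m) (cupR A)) := rfl

variable {A}

/-- Bookkeeping lemma `lptr` of the binor tensor model of Temperley–Lieb recoupling theory (conventions of KL94 §8.2, §9). [folklore] -/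
theorem _root_.Literature.RepresentationTheory.ModularTensorCategories.TemperleyLieb.IsTL.lptr {X : Mor K (m + 1) (n + 1)}
    (hX : IsTL A X) : IsTL A (lptr A X) :=
  (((IsTL.cap.tens (IsTL.idm n)).comp _ (((IsTL.idm 1).tens hX).cast _ _)).comp _
    (IsTL.cup.tens (IsTL.idm m))).cast _ _

/-- Bookkeeping lemma `rptr` of the binor tensor model of Temperley–Lieb recoupling theory (conventions of KL94 §8.2, §9). [folklore] -/
theorem _root_.Literature.RepresentationTheory.ModularTensorCategories.TemperleyLieb.IsTL.rptr {X : Mor K (m + 1) (n + 1)}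
    (hX : IsTL A X) : IsTL A (rptr A X) :=
  (((IsTL.idm n).tens IsTL.cap).comp _ (hX.tens (IsTL.idm 1))).comp _ ((IsTL.idm m).tens IsTL.cup)

/-- Bookkeeping lemma `trAll_cast` of the binor tensor model of Temperley–Lieb recoupling theory (conventions of KL94 §8.2, §9). [folklore] -/
theorem trAll_cast {n n' : ℕ} (X : Mor K n n) (h : n = n') : trAll A (X.cast h h) = trAll A X := by
  subst h; rfl

/-- Bookkeeping lemma `respR_idR_capR` of the binor tensor model of Temperley–Lieb recoupling theory (conventions of KL94 §8.2, §9). [folklore] -/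
theorem respR_idR_capR (n : ℕ) : RespR n (tensR n n (idR n) (capR A)) := by
  simpa using (RespR.idR (K := K) n).tensR (RespR.capR A 0) n
/-- Bookkeeping lemma `respC_idR_capR` of the binor tensor model of Temperley–Lieb recoupling theory (conventions of KL94 §8.2, §9). [folklore] -/
theorem respC_idR_capR (n : ℕ) : RespC (n + 2) (tensR n n (idR n) (capR A)) :=
  (RespC.idR n).tensR (RespC.capR A) n
/-- Bookkeeping lemma `respR_idR_cupR` of the binor tensor model of Temperley–Lieb recoupling theory (conventions of KL94 §8.2, §9). [folklore] -/
theorem respR_idR_cupR (n : ℕ) : RespR (n + 2) (tensR n n (idR n) (cupR A)) :=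
  (RespR.idR n).tensR (RespR.cupR A) n
/-- Bookkeeping lemma `respC_idR_cupR` of the binor tensor model of Temperley–Lieb recoupling theory (conventions of KL94 §8.2, §9). [folklore] -/
theorem respC_idR_cupR (n : ℕ) : RespC n (tensR n n (idR n) (cupR A)) := by
  simpa using (RespC.idR (K := K) n).tensR (RespC.cupR A 0) n

variable (A) in
/-- Left and right partial traces commute. [folklore] -/
theorem lptr_rptr_comm (X : Mor K (n + 2) (n + 2)) : lptr A (rptr A X) = rptr A (lptr A X) := by
  apply ext'
  rw [lptr_val, rptr_val, rptr_val, lptr_val]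
  have hXI_C : RespC (2 + (n + 1)) (tensR 1 1 (idR 1) X.val) := by
    have h := (RespC.idR (K := K) 1).tensR X.respC 1
    rwa [show 1 + (n + 2) = 2 + (n + 1) by omega] at h
  have hXI_R : RespR (2 + (n + 1)) (tensR 1 1 (idR 1) X.val) := by
    have h := (RespR.idR (K := K) 1).tensR X.respR 1
    rwa [show 1 + (n + 2) = 2 + (n + 1) by omega] at h
  -- distribute `𝟙 ⊗ -` on the left-hand side and `- ⊗ 𝟙` on the right-hand side
  rw [idR_tensR_compR, idR_tensR_compR, tensR_compR_idR 1 (RespC.compR _ _ hXI_C) ?c2,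
    tensR_compR_idR 1 ?c3 hXI_R]
  case c2 => (first
    | exact Mor.respC _
    | exact Mor.respR _
    | assumption
    | (apply_rules (maxDepth := 60) [Mor.respC, Mor.respR, RespR.idR, RespC.idR, RespR.compR,
        RespC.compR, RespR.tensR, RespC.tensR, RespR.add, RespC.add, RespR.sub, RespC.sub,
        RespR.smul, RespC.smul, RespR.neg, RespC.neg, RespR.zero, RespC.zero, RespR.capR,
        RespC.capR, RespR.cupR, RespC.cupR]))
  case c3 => (first
    | exact Mor.respC _
    | exact Mor.respR _
    | assumption
    | (apply_rules (maxDepth := 60) [Mor.respC, Mor.respR, RespR.idR, RespC.idR, RespR.compR,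
        RespC.compR, RespR.tensR, RespC.tensR, RespR.add, RespC.add, RespR.sub, RespC.sub,
        RespR.smul, RespC.smul, RespR.neg, RespC.neg, RespR.zero, RespC.zero, RespR.capR,
        RespC.capR, RespR.cupR, RespC.cupR]))
  -- the caps
  have hD : compR (2 + n) (tensR 0 2 (capR A) (idR n))
      (tensR 1 1 (idR 1) (tensR (n + 1) (n + 1) (idR (n + 1)) (capR A))) =
      tensR 0 2 (capR A) (tensR n n (idR n) (capR A)) := by
    rw [tensR_assoc, tensR_idR_idR, show 1 + (n + 1) = 2 + n by omega, ← tensR_idR_idR 2 n,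
      ← tensR_assoc, compR_tensR_tensR (RespC.capR A) (RespR.idR 2), compR_idR (RespC.capR A),
      idR_compR (respR_idR_capR n)]
  have hD' : compR (n + 2) (tensR n n (idR n) (capR A))
      (tensR (n + 1) (2 + (n + 1)) (tensR 0 2 (capR A) (idR (n + 1))) (idR 1)) =
      tensR 0 2 (capR A) (tensR n n (idR n) (capR A)) := by
    rw [show (tensR (n + 1) (2 + (n + 1)) : Raw K → Raw K → Raw K) = tensR (0 + (n + 1)) (2 + (n + 1)) by
        rw [Nat.zero_add], ← tensR_assoc, tensR_idR_idR,
      ← tensR_zero_zero_idR_zero (tensR n n (idR n) (capR A)),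
      show (compR (n + 2) : Raw K → Raw K → Raw K) = compR (0 + (n + 2)) by rw [Nat.zero_add],
      compR_tensR_tensR (RespC.idR 0) (RespR.capR A 0), idR_compR (RespR.capR A 0),
      compR_idR (respC_idR_capR n), tensR_zero_zero_idR_zero]
  -- the cups
  have hE : compR (2 + n) (tensR 1 1 (idR 1) (tensR (n + 1) (n + 1) (idR (n + 1)) (cupR A)))
      (tensR 2 0 (cupR A) (idR n)) = tensR 2 0 (cupR A) (tensR n n (idR n) (cupR A)) := by
    rw [tensR_assoc, tensR_idR_idR, show 1 + (n + 1) = 2 + n by omega, ← tensR_idR_idR 2 n,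
      ← tensR_assoc, compR_tensR_tensR (RespC.idR 2) (RespR.cupR A), idR_compR (RespR.cupR A),
      compR_idR (respC_idR_cupR n)]
  have hE' : compR (n + 1 + 1) (tensR (2 + (n + 1)) (n + 1) (tensR 2 0 (cupR A) (idR (n + 1))) (idR 1))
      (tensR n n (idR n) (cupR A)) = tensR 2 0 (cupR A) (tensR n n (idR n) (cupR A)) := by
    rw [show (tensR (2 + (n + 1)) (n + 1) : Raw K → Raw K → Raw K) = tensR (2 + (n + 1)) (0 + (n + 1)) by
        rw [Nat.zero_add], ← tensR_assoc, tensR_idR_idR,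
      ← tensR_zero_zero_idR_zero (tensR n n (idR n) (cupR A)),
      show (compR (n + 1 + 1) : Raw K → Raw K → Raw K) = compR (0 + (n + 1 + 1)) by rw [Nat.zero_add],
      compR_tensR_tensR (RespC.cupR A 0) (RespR.idR 0), compR_idR (RespC.cupR A 0),
      idR_compR (respR_idR_cupR n), tensR_zero_zero_idR_zero]
  -- the middle
  have hM : tensR (2 + (n + 1)) (2 + (n + 1)) (tensR 1 1 (idR 1) X.val) (idR 1) =
      tensR 1 1 (idR 1) (tensR (n + 1 + 1) (n + 1 + 1) X.val (idR 1)) := by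
    rw [show 2 + (n + 1) = 1 + (n + 1 + 1) by omega, ← tensR_assoc]
  -- assemble
  simp only [← compR_assoc]
  rw [compR_assoc (tensR 0 2 (capR A) (idR n)), hD, hE, compR_assoc (tensR n n (idR n) (capR A)), hD', hE',
    hM, show 1 + (n + 1 + 2) = 2 + (n + 1) + 1 by omega]

/-- A Temperley–Lieb morphism on one strand is a scalar. [cite: KauffmanLins1994, §2.2] -/
theorem isTL_one_eq_smul (hA : A ≠ 0) {X : Mor K 1 1} (hX : IsTL A X) : ∃ c : K, X = c • idm 1 := by
  obtain ⟨c, hc⟩ := comp_jw_eq_smul hA hX (fun m hm => by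
    obtain rfl : m = 0 := by omega
    rw [Delta_zero]; exact one_ne_zero)
  rw [jw_one, comp_idm] at hc
  exact ⟨c, hc⟩

variable (A) in
/-- Bookkeeping lemma `lptr_idm_one` of the binor tensor model of Temperley–Lieb recoupling theory (conventions of KL94 §8.2, §9). [folklore] -/
theorem lptr_idm_one : lptr A (idm 1 : Mor K 1 1) = dval A • idm 0 := by
  apply ext'
  rw [lptr_val, smul_val, idm_val, idm_val, tensR_idR_idR, tensR_idR_zero, compR_idR (RespC.capR A),
    show (tensR 2 0 (cupR A) (idR 0) : Raw K) = cupR A from tensR_idR_zero _, capR_cupR]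

variable (A) in
/-- Bookkeeping lemma `rptr_idm_one` of the binor tensor model of Temperley–Lieb recoupling theory (conventions of KL94 §8.2, §9). [folklore] -/
theorem rptr_idm_one : rptr A (idm 1 : Mor K 1 1) = dval A • idm 0 := by
  have e : (idm 0 ⊗ₘ idm 1 : Mor K (0 + 1) (0 + 1)) = idm 1 := idm_tens_idm 0 1
  rw [show (idm 1 : Mor K 1 1) = idm 0 ⊗ₘ idm 1 from e.symm, rptr_tens_idm_one]

variable (A) in
/-- Bookkeeping lemma `lptr_smul` of the binor tensor model of Temperley–Lieb recoupling theory (conventions of KL94 §8.2, §9). [folklore] -/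
theorem lptr_smul (c : K) (X : Mor K (m + 1) (n + 1)) : lptr A (c • X) = c • lptr A X := by
  apply ext'
  rw [lptr_val, smul_val, smul_val, lptr_val, tensR_smul, compR_smul, smul_compR]

/-- **Sphericality**: closing the first strand on the left or tracing everything on the right gives the
same number for Temperley–Lieb morphisms. [cite: KauffmanLins1994, §2.2 (planar isotopy of closed networks)] -/
theorem trAll_lptr (hA : A ≠ 0) : ∀ {n : ℕ} {X : Mor K (n + 1) (n + 1)}, IsTL A X →
    trAll A (lptr A X) = trAll A X := by
  intro n
  induction n with
  | zero =>
    intro X hX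
    obtain ⟨c, rfl⟩ := isTL_one_eq_smul hA hX
    rw [lptr_smul, lptr_idm_one, trAll_succ, rptr_smul, rptr_idm_one]
  | succ n ih =>
    intro X hX
    rw [trAll_succ, ← lptr_rptr_comm, ih hX.rptr, ← trAll_succ]

variable (A) in
/-- Left sliding: `lptr (Y (𝟙 ⊗ N)) = lptr Y ∘ N`. [folklore] -/
theorem lptr_comp_idm_one_tens {a b : ℕ} (Y : Mor K (b + 1) (a + 1)) (N : Mor K a b) :
    lptr A (Y ⊚ (idm 1 ⊗ₘ N :).cast (Nat.add_comm 1 a) (Nat.add_comm 1 b)) = lptr A Y ⊚ N := by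
  apply ext'
  rw [lptr_val, comp_val, comp_val, lptr_val, cast_val, tens_val, idm_val, idR_tensR_compR, tensR_assoc,
    tensR_idR_idR]
  simp only [← compR_assoc, Nat.reduceAdd]
  rw [show 1 + (b + 1) = 2 + b by omega, compR_tensR_tensR (RespC.idR 2) (RespR.cupR A),
    idR_compR (RespR.cupR A), compR_idR N.respC]
  congr 2
  rw [show (compR b : Raw K → Raw K → Raw K) = compR (0 + b) by rw [Nat.zero_add],
    ← tensR_zero_zero_idR_zero N.val, compR_tensR_tensR (RespC.cupR A 0) (RespR.idR 0),
    compR_idR (RespC.cupR A 0), idR_compR N.respR, tensR_zero_zero_idR_zero]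

end Mor

end TemperleyLieb

end Literature.RepresentationTheory.ModularTensorCategories
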